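import Literature.ComputerArithmetic.RumpOgitaOishi2009.AccSign
import Literature.ComputerArithmetic.RumpOgitaOishi2009.KFoldFaithful

/-!
# Rump–Ogita–Oishi, *Accurate floating-point summation part II*: §6 algorithms for K-fold accuracy
# (Lemma 6.1, Algorithm 6.2 `TransformK`, Lemma 6.3 with its Appendix proof of (6.5), Algorithm 6.4
# `AccSumK`, Proposition 6.5)

HONEST FRAMING (ENGINES group, unit `eng-quad-4`, kernels lane of the `certquad` engine — shared
numerical engines serving client cells; rigour lives in the verifiers; every published number
belongs to a client cell's ledger, not to the engines group): §6 of Part II is typed and proved at FORMAT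
LEVEL, in the model of the lane's Part I files (`RumpOgitaOishi2008.ExtractVector`, `.AccSum`) and of
`RumpOgitaOishi2009.AccSign` (§§3–4) and `.KFoldFaithful` (§5): the tree's binary floating-point numbers
`JeannerodRump2018.IsFloat p emin` (precision `p`, gradual underflow from `emin`, NO overflow) and an ARBITRARY
rounding to nearest `fl` (`IsRoundNearest p emin fl`, any tie rule), exact rational arithmetic for the analysis.
This file carries the K-fold part of the paper: LEMMA 6.1 (two successive faithful roundings produced by the
code (3.7) do not overlap), ALGORITHM 6.2 (`TransformK`: the code (3.7) followed by `R = fl(τ₂ − (res − τ₁))`),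
LEMMA 6.3 (`res ∈ □(s + ϱ)`, the error-free relation (6.1) `s + ϱ − res = R + Σ p′ᵢ`, the grid fact (6.2) which
allows cascading, and (6.3) "no rounding error occurs in the computation of `R`" — whose proof, (6.5), is the
paper's APPENDIX, typed here in full), ALGORITHM 6.4 (`AccSumK`) and PROPOSITION 6.5 (`AccSumK` delivers a
strongly faithful rounding `Res₁, …, Res_K` of `s = Σ pᵢ`, the relation (6.6), the exact case and the bounds
(6.7)–(6.8)) — all PROVED, sorry-free, for every precision and exponent range admitted by the printed
hypothesis `2^(2M)eps ≤ 1`; one sentence of the printed PROOF of Proposition 6.5 is false as worded and is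
replaced (NOTE (c), with a kernel-checked example run of the algorithm). No hardware, timing, flop-count
((4m + 5K + 3)n) or IEEE-format claims: `p` and `emin` are parameters.

Source read at the page: [RumpOgitaOishi2009] S. M. Rump, T. Ogita, S. Oishi, *Accurate floating-point
summation part II: sign, K-fold faithful and rounding to nearest*, SIAM J. Sci. Comput. 31(2) (2008/09)
1269–1302, doi:10.1137/07068816X; read in the authors' version (30 pp.; its page numbers are used): p. 12 (§6
introduction, Lemma 6.1 and its proof, the discussion "we have no equation relating `s, ϱ, res` and `p′`",
Algorithm 6.2 `TransformK`, Lemma 6.3 with eqs. (6.1)–(6.3)), p. 13 (the flop count, Remarks 1–3, the proof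
of Lemma 6.3 with eqs. (6.4)–(6.5) and the derivation of (6.1), (6.2); Algorithm 6.4 `AccSumK`; Proposition
6.5, hypotheses), p. 14 (Proposition 6.5, conclusion: strongly faithful, eq. (6.6), "`Res_k ∈ U` for some `k`
implies `Res = s`", eqs. (6.7)–(6.8); Remarks 1–4; the proof of Proposition 6.5; the closing paragraph on why
(6.1)/(6.2) matter), p. 27 (§10 Appendix: (10.1) `R̃ := τ₂ − Δ ∈ F`, (10.2) `σ ≥ eps⁻¹eta`, (10.3) `Δ ∈ F`),
p. 28 (the facts (10.4)–(10.6) and their proofs; "Proof of (10.1)": the cases `|τ₁| < σ`, `σ ≤ |τ₁| < ⅗eps⁻¹σ`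
with (10.7), "we may assume `res ≠ τ₁`", (10.8)), p. 29 (the cases `⅗eps⁻¹σ ≤ |τ₁| < eps⁻¹σ` and
`|τ₁| ≥ eps⁻¹σ` with the "`m = 1`" argument, (10.9), (10.10), the conclusion). Also used: p. 2 (eq. (2.1),
`U`), pp. 5–7 (Lemma 3.4, Lemma 3.5 with (3.7)–(3.15), typed in `AccSign`), pp. 9–11 (§5, typed in
`KFoldFaithful`).

DICTIONARY (source ↦ here; carrier `ℚ`; the dictionaries of `ExtractVector`, `AccSum`, `AccSign` and
`KFoldFaithful` — `F ↦ IsFloat p emin`, `fl ↦ fl` with `IsRoundNearest p emin fl`, `eps ↦ unitRoundoff p = 2^-p`,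
`eta ↦ 2^emin`, `½eps⁻¹eta ↦ 2^(emin+p-1)`, `f ∈ U ↦ |f| ≤ 2^(emin+p-1)` (eq. (2.1)), `ufp ↦ RumpOgitaOishi2008.ufp`,
`gℤ ↦ OnGrid g`, `f ∈ □(r) ↦ IsFaithfulRounding p emin f r`, `μ = max |pᵢ| ↦ maxAbs xs`, `M = ⌈log₂(n + 2)⌉ ↦
Nat.clog 2 (xs.length + 2)`, `⌈log₂ μ⌉ ↦ Int.clog 2 (maxAbs xs)`, `σ₀ = 2^(M + ⌈log₂ μ⌉)`, `2^(2M)eps ≤ 1 ↦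
2 * Nat.clog 2 (xs.length + 2) ≤ p`, `Transform(p, ϱ)` with `Φ = 2^(2M)eps ↦ transformPhi fl p emin
(2 ^ (2 * M) * unitRoundoff p) xs ϱ` and its assertions `TransformPhiSpec` (Lemma 3.4), the code (3.7) `res =
fl(τ₁ + (τ₂ + (Σ p′ᵢ))) ↦ accSumOffset fl p emin xs ϱ` (Lemma 3.5), `fl(Σ pᵢ)` (recursive) `↦ flSum fl`,
non-overlapping `↦ NonOverlapStep` / `NonOverlapping`, (K-fold) faithful / strongly faithful rounding of `s` `↦
IsKFoldFaithful` / `IsStronglyFaithful p emin l s` — continue).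
* ALGORITHM 6.2 `[res, R, p′] = TransformK(p, ϱ)` ↦ `transformK fl p emin xs ϱ : ℚ × ℚ × List ℚ` (`res`, `R`,
  `p′`; the output `σ` of `Transform` "is not needed but added for clarity" in the source and is dropped, `M` is
  the closed expression `Nat.clog 2 (n + 2)`).
* ALGORITHM 6.4 ↦ `accSumK fl p emin xs K : List ℚ` (the result vector `Res` of length `K`), computed by the loop
  `accSumKAux fl p emin K xs R : List ℚ × ℚ × List ℚ` on the state `(p⁽ᵏ⁻¹⁾, R_{k−1})` with `K` = the number of
  remaining steps, which also returns the final state `(R, p)` entering (6.6); "if `Res_k ∈ U`,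
  `Res_{k+1..K} = 0`, return" ↦ the branch `|Res_k| ≤ 2^(emin+p-1)`, output `Res_k :: replicate (K−k) 0` and the
  state `(R_k, p⁽ᵏ⁾)` of the exit step.
* `s_k := Σᵢ p⁽ᵏ⁾ᵢ ↦ (…).2.2.sum`; `Res := Σ Res_k ↦ (accSumK …).sum`; "`Res_k ∈ U` for some `k`" ↦
  `∃ r ∈ accSumK …, |r| ≤ 2^(emin+p-1)`; "`Res_k ∉ U`" (for the bounds (6.7)–(6.8), i.e. no exit: `Res_K ∉ U`) ↦
  `2^(emin+p-1) < |(accSumK …).getLast _|`.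
* Appendix: `t = t⁽ᵐ⁻¹⁾`, `τ = τ⁽ᵐ⁾` (last pass), `τ₃ = fl(Σ p′ᵢ)`, `τ₂′ = fl(τ₂ + τ₃)`, `res = fl(τ₁ + τ₂′)`,
  `Δ = res − τ₁`, `R̃ = τ₂ − Δ` — as in (3.12) and (10.1)–(10.3); `e := epsσ`, `A := ufp(τ₁)`, `m := 2ᴹ` in the
  proof.

Typed and PROVED (all sorry-free; `[cite: …]` locators on every declaration):

* LEMMA 6.1 — `nonOverlapStep_of_faithful` (the mechanism: `f₁ ∈ F`, `r ∈ etaℤ`, (3.10) for `f₁ ≠ 0`,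
  `f₁ = 0 ⟹ r = 0`, `f₂ ∈ □(r − f₁)` ⟹ `f₁, f₂` non-overlapping; needs only `2^(M+2)eps ≤ 1`) and
  `nonOverlapStep_accSumOffset` (as printed, for `res` of the code (3.7) and any `f ∈ □(s + ϱ − res)`; the zero
  vector included).
* ALGORITHM 6.2 — `transformK`, `transformK_fst` (`= accSumOffset`, the code (3.7)), `transformK_snd_snd` (`p′`),
  `transformK_of_maxAbs_eq_zero` (`TransformK(p, ϱ) = [ϱ, 0, p]` for the zero vector `p`).
* APPENDIX, proof of (6.5) — `exact_correction_of_transformPhiSpec`: over the assertions `TransformPhiSpec` of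
  Lemma 3.4 (any state a run of `Transform` with `Φ = 2^(2M)eps` can stop in), `σ > ½eps⁻¹eta`, and any `τ₃ ∈ F`
  with (3.14) `|τ₃| ≤ n·epsσ`: (6.4) `|τ₂′| ≤ |τ₁|` and `Δ = fl(res − τ₁) ∈ F`, (6.5) `R̃ = τ₂ − Δ ∈ F` and
  `fl(τ₂ − Δ) = R̃`, and the grid form of (6.2) `R̃ ∈ 2^(2M)eps·epsσ·ℤ`.
* LEMMA 6.3 — `isFloat_flSum` (`fl(Σ p′ᵢ) ∈ F`), `transformK_spec`: `res ∈ □(s + ϱ)`; (6.1); "if `res = 0` then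
  `s + ϱ = 0` and `R`, `p′` vanish"; `R ∈ F`, `p′ᵢ ∈ F`, `p′` of length `n`; (6.2) `R ∈ epsσ′ℤ` for `p′ ≠ 0`,
  `σ′ = 2^(M + ⌈log₂ μ′⌉)`; (6.3) `Δ = fl(res − τ₁) = res − τ₁`, `R = τ₂ − Δ`. Hypotheses: `pᵢ ∈ F`, `2^(2M)eps ≤ 1`,
  `ϱ ∈ F`, and `ϱ ∈ epsσ₀ℤ` WHEN `p ≠ 0` (the zero vector is covered: `TransformK(p, ϱ) = [ϱ, 0, p]` there).
* ALGORITHM 6.4 — `accSumKAux`, `accSumK`, the unfolding equations `accSumKAux_zero` / `_succ_of_mem_U` /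
  `_succ_of_not_mem_U`, `accSumKAux_fst_eq_take` / `accSumK_eq_take` (`AccSumK(p, k)` is the prefix of
  `AccSumK(p, K)`), `isKFoldFaithful_replicate_zero`.
* PROPOSITION 6.5 — `accSumKAux_spec` (the loop invariant: `K` results, a K-fold faithful rounding of
  `s_{k−1} + R_{k−1}`, non-overlapping, and (6.6)), `length_accSumK`, `isStronglyFaithful_accSumK` (the main
  statement), `accSumK_eq_6_6` ((6.6) with the final state; for `1 ≤ k ≤ K` combine with `accSumK_eq_take`),
  `IsKFoldFaithful.sum_eq_of_exists_mem_U` (Lemma 5.5 / (5.13): SOME member in `U` and `s ∈ etaℤ` ⟹ `Σ fν = s`),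
  `sum_accSumK_eq_of_mem_U` ("`Res_k ∈ U` for some `k` implies `Res = s`"), `abs_sub_sum_accSumK_lt` ((6.7) and
  (6.8), all four inequalities, for `Res_K ∉ U`).
* The worked example behind NOTE (c) (`eps = 2⁻¹⁰`, `eta = 1`, `p = (257, −224)`, ANY rounding to nearest):
  `extractVector_example`, `transformPhi_example` (`[τ₁, τ₂, p⁽¹⁾, σ] = [32, 0, (1, 0), 2048]` after one pass),
  `accSumOffset_example` (`res = 33`), `transformK_example` (`[33, −1, (1, 0)]`), `accSumKAux_example`
  (`AccSumK` returns at `k = 1` with `Res = (33, 0, …, 0)`, `R₁ = −1`, `p⁽¹⁾ = (1, 0)`),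
  `prop_6_5_proof_clause_fails`; private arithmetic helpers (`fl(2305) = 2304` for every tie rule, `⌈log₂ 257⌉ = 9`,
  …).

NOTES. (a) STATEMENTS. Lemma 6.1 is proved from the weaker `2^(M+2)eps ≤ 1` (the source: `2^(2M)eps ≤ 1`,
`M ≥ 2`), in the abstract form "(3.10) + `f₂ ∈ □(s + ϱ − f₁)` ⟹ non-overlapping", for BOTH cases of the printed
proof at once (`f₂ ∈ U` forces `f₂ = s + ϱ − f₁` exactly since `s + ϱ − f₁ ∈ etaℤ`; then (3.10) alone gives
(5.4)); the clause `f₁ = 0 ⟹ f₂ = 0` of Definition 5.2 comes from Lemma 3.5's "`res = 0 ⟹ s + ϱ = 0`". Lemma 6.3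
and Proposition 6.5 are stated for ALL input vectors: the source's standing "nonzero vector `p`" is needed only
for the grid hypothesis `ϱ ∈ epsσ₀ℤ` (`σ₀` is undefined for `p = 0`), which is therefore asked only when `p ≠ 0`;
on the zero vector `TransformK(p, ϱ) = [ϱ, 0, p]` and every assertion holds trivially ("for zero input vector
`p` the assertions are evident"). This matters for the cascade: after a step with `p⁽ᵏ⁾ = 0` the next offset
`R_k` need not lie on any particular grid. Proposition 6.5 is proved for every `K ∈ ℕ` (`K = 0`: the empty
sequence); (6.6) is stated with the loop's final state `(R, p)` — for a run that returns at step `k₀ ≤ K` this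
is `(R_{k₀}, p⁽ᵏ⁰⁾)`, the only state the algorithm defines, and `Res_ν = 0` for `ν > k₀`.
(b) THE APPENDIX. `exact_correction_of_transformPhiSpec` follows the source's case distinction with the
thresholds `|τ₁| < σ` / `σ ≤ |τ₁|` and `eps|τ₁| < ⅗σ` / `⅗σ ≤ eps|τ₁| < σ` / `σ ≤ eps|τ₁|`, and the source's
estimates (10.3)-type bound `|τ₂′ − τ₂| ≤ eps|τ₂| + (1 + eps)|τ₃|`, (10.4) (`res, τ₁, τ₂ ∈ epsσℤ` once
`σ ≤ |τ₁|`), (10.7). Two ingredients are organised differently, with the same content: (i) instead of the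
`pred`/`succ` calculus of (10.5), (10.6), (10.8), (10.10) it uses the two rounding facts they rest on — every
`g ∈ F` below `τ₁` is `≤ res` and every `g ∈ F` above `τ₁` is `≥ res` (because `τ₁ = fl(τ₁ + τ₂)` is a NEAREST
rounding, so `|τ₂| ≤ ½|g − τ₁|`, while `|τ₂′ − τ₂| < ½eps·ufp(τ₁) ≤ ½|g − τ₁|`), and `Δ ≠ 0 ⟹ sign(τ₂) = sign(Δ)`;
(ii) instead of the "`m = 1`" argument leading to (10.9) (which needs the initial value `t⁽⁰⁾ = ϱ`, not part of
the loop invariant) it uses `|τ₂| ≤ |τ⁽ᵐ⁾| ≤ n·2⁻ᴹσ ≤ (1 − 2^(1−M))σ`, valid after ANY number of passes because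
`t⁽ᵐ⁻¹⁾ ∈ F` is a candidate for the nearest rounding `τ₁ = fl(t⁽ᵐ⁻¹⁾ + τ⁽ᵐ⁾)` — this is all that (10.9) is used
for. The theorem is deliberately stated over `TransformPhiSpec` (`|τ| ≤ n·2⁻ᴹσ`, and the `Φ`-exit inequality
(3.5)/(3.11) `ufp(τ₁) ≥ 2^(2M)epsσ`): over the WEAKER Part I interface `TransformSpec` (`|τ| < σ` only) the
conclusion (6.5) is false (by hand: `p = 8`, `M = 2`, `n = 2`, `σ = 4`, `t = 1032`, `τ = 4 − 2⁻⁶`, `τ₃ = 2⁻⁵`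
give, with ties to even, `τ₁ = 1032`, `τ₂′ = 4`, `res = 1040` and `R̃ = −257·2⁻⁶ ∉ F`), so the sharper bound on
`τ` from Theorem 3.2 is genuinely used, as in the source.
(c) THE PROOF OF PROPOSITION 6.5 states "… which is true because `Res_k ∈ U` implies `R_k` and all `p⁽ᵏ⁾ᵢ` to
be zero by Lemma 6.3." Lemma 6.3 asserts this for `res = 0` only, and the claim is FALSE for `Res_k ∈ U ∖ {0}`:
`prop_6_5_proof_clause_fails` — with `eps = 2⁻¹⁰`, `eta = 1` (`2^(2M)eps = 2⁻⁶`), `p = (257, −224)` (`s = 33`) and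
ANY rounding to nearest, `TransformK(p, 0) = [33, −1, (1, 0)]`: `Res₁ = 33 ∈ U` (`½eps⁻¹eta = 512`) while
`R₁ = −1` and `p⁽¹⁾ = (1, 0)` (the run: `σ₀ = 2¹¹`, `q = (256, −224)`, `fl(2048 + 257) = 2304` being the only
inexact operation, `t⁽¹⁾ = 32 = fl(Φσ₀)` so the loop stops after one pass, `τ₁ = 32`, `τ₂ = 0`, `fl(Σ p⁽¹⁾ᵢ) = 1`,
`res = 33`, `Δ = 1`, `R = −1`). What IS true, and suffices: at a `return`, `Res_k ∈ U` is a faithful rounding of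
`s_{k−1} + R_{k−1} ∈ etaℤ`, hence EQUAL to it ((5.3), `KFoldFaithful.faithful_eq_of_mem_U_of_onGrid`), so the
padded zeros are faithful roundings of the remainders `0`, the sequence stays non-overlapping (trailing zeros,
Definition 5.2), and (6.6) holds with the state `(R_k, p⁽ᵏ⁾)` by (6.1) (`R_k + s_k = 0` there, though not
termwise). The clause of Proposition 6.5 "`Res_k ∈ U` for some `k` implies `Res = s`" is proved via Lemma 5.5
(`IsKFoldFaithful.sum_eq_of_exists_mem_U`).
(d) CONVENTIONS. `fl(Σ p′ᵢ)` is recursive summation `flSum` (any order would do for Lemma 3.5; the algorithm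
text fixes none); the `if Res_k ∈ U` test is `|Res_k| ≤ ½eps⁻¹eta` per (2.1). `transformK_spec` is stated
with `let` abbreviations for the components of `TransformK` and `Transform`; the loop `accSumKAux` returns the
final state so that (6.6) can be stated. `M` is not an output (Remark 3). Not typed: the flop counts and Remarks 1–2, 4 of p. 14 (performance /
implementation advice), Remark 3's IEEE-format constants `K ≤ 12` / `K ≤ 40` (format-specific arithmetic on
the exponent range; the underlying fact "`s ∈ etaℤ`, so some `K` stores `s` exactly" is the exact case above
together with (5.6)), and §§7–9 (rounding to nearest `AccSumNearest`, directed roundings, timings) — other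
files of the directory if wanted.
-/

namespace Literature.ComputerArithmetic.RumpOgitaOishi2009

open Literature.ComputerArithmetic.JeannerodRump2018
open Literature.ComputerArithmetic.JeannerodRump2018.SumTree
open Literature.ComputerArithmetic.BoldoJeannerodMelquiondMuller2023
open Literature.ComputerArithmetic.JoldesMullerPopescu2017 (isFloat_two_zpow two_zpow_emin_le_abs)
open Literature.ComputerArithmetic.LangeRump2018 (abs_list_sum_le exact_eq_leaves_sum)
open Literature.ComputerArithmetic.RumpOgitaOishi2008

variable {p : ℕ} {emin : ℤ} {fl : ℚ → ℚ}

/-! ### §6, Lemma 6.1: successive faithful roundings of `s + ϱ` do not overlap -/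

/-- LEMMA 6.1, the mechanism (Lemma 5.1 applied to (3.10)): let `f₁ ∈ F`, `r ∈ etaℤ` with
`f₁ = 0 ⟹ r = 0` and, for `f₁ ≠ 0`, (3.10) `|r − f₁| < 2eps(1 − 2^(−M−1))ufp(f₁)` where `2ᴹ⁺²eps ≤ 1`, and let
`f₂ ∈ □(r − f₁)`. Then `f₁, f₂` are non-overlapping: "if `res ∈ U`, then `Δ ∈ F` by (5.3) [indeed `Δ = r − f₁ ∈ etaℤ`,
so `f₂ = Δ`] … Otherwise Lemma 5.1 yields (6.2) `|f − Δ| < 2eps·ufp(Δ) ≤ 2eps|Δ|`, hence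
`|f| < (1 + 2eps)|Δ| < 2eps(1 + 2eps)(1 − 2^(−M−1))ufp(res) ≤ 2eps·ufp(res)` by (2.6), `2^(2M)eps ≤ 1`
(here from the weaker `2^(M+2)eps ≤ 1`, i.e. `2eps ≤ 2^(−M−1)`). For `f₁ = 0`, `f₂ ∈ □(0)` is `0`
(Definition 5.2, second clause). [cite: RumpOgitaOishi2009, Lemma 6.1 (proof, eq. (6.2))] -/
theorem nonOverlapStep_of_faithful (hp : 1 ≤ p) {M : ℕ} (hMp : M + 2 ≤ p) {f₁ f₂ r : ℚ}
    (hf₁ : IsFloat p emin f₁) (hr : OnGrid ((2 : ℚ) ^ emin) r)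
    (h310 : f₁ ≠ 0 → |r - f₁| < 2 * unitRoundoff p * (1 - 1 / 2 ^ (M + 1)) * ufp f₁)
    (hzero : f₁ = 0 → r = 0) (hf₂ : IsFaithfulRounding p emin f₂ (r - f₁)) :
    NonOverlapStep p f₁ f₂ := by
  refine ⟨fun hne => ?_, fun h0 => hf₂.sign.2.2 (by rw [hzero h0, h0, sub_zero])⟩
  have hlt := h310 hne
  have hu0 : 0 < unitRoundoff p := u_pos
  have hA0 : 0 < ufp f₁ := ufp_pos hne
  have hc0 : (0 : ℚ) < 1 / 2 ^ (M + 1) := by positivity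
  -- `2eps ≤ 2^(−M−1)` from `2^(M+2) ≤ 2^p`
  have hc : 2 * unitRoundoff p ≤ 1 / 2 ^ (M + 1) := by
    have h1 : (2 : ℚ) ^ (M + 1) * 2 ≤ 2 ^ p := by
      rw [← pow_succ]; exact pow_le_pow_right₀ (by norm_num) (by omega)
    have h2 : (0 : ℚ) < 2 ^ (M + 1) := by positivity
    have h3 : (0 : ℚ) < 2 ^ p := by positivity
    rw [unitRoundoff, le_div_iff₀ h2, show 2 * (1 / (2 : ℚ) ^ p) * 2 ^ (M + 1) = 2 ^ (M + 1) * 2 / 2 ^ p by ring,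
      div_le_one h3]
    exact h1
  have hkey : (1 + 2 * unitRoundoff p) * (1 - 1 / 2 ^ (M + 1)) ≤ 1 := by
    have := mul_nonneg (mul_nonneg (by norm_num : (0 : ℚ) ≤ 2) hu0.le) hc0.le
    nlinarith [hc, this]
  have hle1 : 1 - 1 / (2 : ℚ) ^ (M + 1) ≤ 1 := by linarith
  rcases lt_or_ge ((2 : ℚ) ^ (emin + p - 1)) |f₂| with hU | hU
  · -- `f₂ ∉ U`: (5.2) `|Δ − f₂| < 2eps·ufp(Δ) ≤ 2eps|Δ|`, so `|f₂| < (1 + 2eps)|Δ|`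
    have h52 := (faithful_abs_sub_lt_two_u_ufp hp hf₂ hU).1
    have hD := ufp_le_abs (r - f₁)
    have htri : |f₂| ≤ |r - f₁| + |r - f₁ - f₂| := by
      have h : f₂ = (r - f₁) - (r - f₁ - f₂) := by ring
      calc |f₂| = |(r - f₁) - (r - f₁ - f₂)| := by rw [← h]
        _ ≤ |r - f₁| + |r - f₁ - f₂| := abs_sub _ _
    calc |f₂| ≤ |r - f₁| + |r - f₁ - f₂| := htri
      _ < |r - f₁| + 2 * unitRoundoff p * ufp (r - f₁) := by linarith
      _ ≤ |r - f₁| + 2 * unitRoundoff p * |r - f₁| := by gcongr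
      _ = (1 + 2 * unitRoundoff p) * |r - f₁| := by ring
      _ ≤ (1 + 2 * unitRoundoff p) * (2 * unitRoundoff p * (1 - 1 / 2 ^ (M + 1)) * ufp f₁) :=
          mul_le_mul_of_nonneg_left hlt.le (by positivity)
      _ = ((1 + 2 * unitRoundoff p) * (1 - 1 / 2 ^ (M + 1))) * (2 * unitRoundoff p * ufp f₁) := by ring
      _ ≤ 1 * (2 * unitRoundoff p * ufp f₁) := mul_le_mul_of_nonneg_right hkey (by positivity)
      _ = 2 * unitRoundoff p * ufp f₁ := one_mul _
  · -- `f₂ ∈ U`: `Δ = r − f₁ ∈ etaℤ`, so `f₂ = Δ` by (5.3)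
    have hDg : OnGrid ((2 : ℚ) ^ emin) (r - f₁) := hr.sub (onGrid_eta_of_isFloat hf₁)
    rw [faithful_eq_of_mem_U_of_onGrid hp hf₂ hU hDg]
    calc |r - f₁| < 2 * unitRoundoff p * (1 - 1 / 2 ^ (M + 1)) * ufp f₁ := hlt
      _ ≤ 2 * unitRoundoff p * 1 * ufp f₁ := by gcongr
      _ = 2 * unitRoundoff p * ufp f₁ := by ring

/-- **LEMMA 6.1.** Let `p` be a vector of `n` floating-point numbers, `M = ⌈log₂(n + 2)⌉`, `2^(2M)eps ≤ 1`,
`ϱ ∈ F ∩ epsσ₀ℤ` (the hypotheses of Lemma 3.5; the grid condition only matters for nonzero `p`), let `res` be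
computed by the piece of code (3.7)
(`[τ₁, τ₂, p′, σ] = Transform(p, ϱ)`, `res = fl(τ₁ + (τ₂ + Σ p′ᵢ))`, `accSumOffset`), so that `res ∈ □(s + ϱ)`,
and let `f ∈ □(s + ϱ − res)`. "Then `res` and `f` are non-overlapping." (For the zero vector, excluded in the
source, `res = ϱ = s + ϱ` and `f ∈ □(0)` is `0`, so the conclusion holds as well.)
[cite: RumpOgitaOishi2009, Lemma 6.1] -/
theorem nonOverlapStep_accSumOffset (hfl : IsRoundNearest p emin fl) {xs : List ℚ}
    (hxs : ∀ x ∈ xs, IsFloat p emin x) (h2M : 2 * Nat.clog 2 (xs.length + 2) ≤ p) {ϱ : ℚ}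
    (hϱ : IsFloat p emin ϱ)
    (hϱg : maxAbs xs ≠ 0 →
      OnGrid (unitRoundoff p * (2 : ℚ) ^ ((Nat.clog 2 (xs.length + 2) : ℤ) + Int.clog 2 (maxAbs xs))) ϱ)
    {f : ℚ} (hf : IsFaithfulRounding p emin f (xs.sum + ϱ - accSumOffset fl p emin xs ϱ)) :
    NonOverlapStep p (accSumOffset fl p emin xs ϱ) f := by
  by_cases hμ : maxAbs xs = 0
  · obtain ⟨h1, h2⟩ := accSumOffset_of_maxAbs_eq_zero hfl hμ hϱ
    have h0 : xs.sum + ϱ - accSumOffset fl p emin xs ϱ = 0 := by rw [h1, h2]; ring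
    rw [h0] at hf
    rw [hf.sign.2.2 rfl]
    exact nonOverlapStep_zero_right _
  · have hnil : xs ≠ [] := by rintro rfl; exact hμ rfl
    have hM : 2 ≤ Nat.clog 2 (xs.length + 2) := two_le_clog_length_add_two hnil
    have hp : 1 ≤ p := by omega
    obtain ⟨hfaith, hzero, h310⟩ := accSumOffset_spec_of_maxAbs_ne_zero hfl hxs hμ h2M hϱ (hϱg hμ)
    have hsg : OnGrid ((2 : ℚ) ^ emin) (xs.sum + ϱ) :=
      (onGrid_list_sum fun x hx => onGrid_eta_of_isFloat (hxs x hx)).add (onGrid_eta_of_isFloat hϱ)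
    exact nonOverlapStep_of_faithful hp (M := Nat.clog 2 (xs.length + 2)) (by omega) hfaith.1 hsg h310
      (fun h0 => (hzero h0).2.2.2) hf

/-! ### §6, Algorithm 6.2: `TransformK` — error-free vector transformation with faithful rounding -/

/-- **ALGORITHM 6.2 (`TransformK`): error-free vector transformation including faithful rounding.**
`[res, R, p′] = TransformK(p, ϱ)`: `[τ₁, τ₂, p′, σ] = Transform(p, ϱ)` with the parameter `Φ` replaced by
`2^(2M)eps`, `res = fl(τ₁ + (τ₂ + Σ p′ᵢ))` (the code (3.7), `accSumOffset`), `R = fl(τ₂ − (res − τ₁))`. The format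
parameters `p` (`eps = 2^-p`) and `emin` are arguments as in `transformPhi`; the inner sum `Σ p′ᵢ` is recursive
summation from the left (`flSum`), as in (3.7). [cite: RumpOgitaOishi2009, Algorithm 6.2] -/
def transformK (fl : ℚ → ℚ) (p : ℕ) (emin : ℤ) (xs : List ℚ) (ϱ : ℚ) : ℚ × ℚ × List ℚ :=
  (accSumOffset fl p emin xs ϱ,
    fl ((transformPhi fl p emin (2 ^ (2 * Nat.clog 2 (xs.length + 2)) * unitRoundoff p) xs ϱ).2.1 -
      fl (accSumOffset fl p emin xs ϱ -
        (transformPhi fl p emin (2 ^ (2 * Nat.clog 2 (xs.length + 2)) * unitRoundoff p) xs ϱ).1)),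
    (transformPhi fl p emin (2 ^ (2 * Nat.clog 2 (xs.length + 2)) * unitRoundoff p) xs ϱ).2.2.1)

/-- `TransformK(p, ϱ)₁ = res` is the result of the code (3.7) (Lemma 3.5 / Lemma 6.1).
[cite: RumpOgitaOishi2009, Algorithm 6.2] -/
theorem transformK_fst (fl : ℚ → ℚ) (p : ℕ) (emin : ℤ) (xs : List ℚ) (ϱ : ℚ) :
    (transformK fl p emin xs ϱ).1 = accSumOffset fl p emin xs ϱ := rfl

/-- `TransformK(p, ϱ)₃ = p′` is the vector `p′ = Transform(p, ϱ)₃`. [cite: RumpOgitaOishi2009, Algorithm 6.2] -/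
theorem transformK_snd_snd (fl : ℚ → ℚ) (p : ℕ) (emin : ℤ) (xs : List ℚ) (ϱ : ℚ) :
    (transformK fl p emin xs ϱ).2.2 =
      (transformPhi fl p emin (2 ^ (2 * Nat.clog 2 (xs.length + 2)) * unitRoundoff p) xs ϱ).2.2.1 := rfl

/-- On the zero vector (`μ = 0`, `Transform` returns `τ₁ = ϱ`, `τ₂ = 0`, `p′ = p`): `TransformK(p, ϱ) = [ϱ, 0, p]`
for `ϱ ∈ F` (`res = fl(ϱ + fl(0 + 0)) = ϱ`, `R = fl(0 − fl(ϱ − ϱ)) = 0`).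
[cite: RumpOgitaOishi2009, Algorithm 6.2 / Algorithm 3.3 ("if μ = 0")] -/
theorem transformK_of_maxAbs_eq_zero (hfl : IsRoundNearest p emin fl) {xs : List ℚ} (h : maxAbs xs = 0)
    {ϱ : ℚ} (hϱ : IsFloat p emin ϱ) : transformK fl p emin xs ϱ = (ϱ, 0, xs) := by
  obtain ⟨h1, -⟩ := accSumOffset_of_maxAbs_eq_zero hfl h hϱ
  have h0 : IsFloat p emin 0 := isFloat_zero p emin
  simp only [transformK, h1, transformPhi_of_maxAbs_eq_zero fl p emin _ ϱ h, sub_self, fl_eq_self hfl h0]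

/-! ### Appendix: the proof of (6.5) — `R = fl(τ₂ − (res − τ₁))` is computed without rounding error -/

/-- **APPENDIX (proof of (6.5)), abstract form.** Let `[τ₁, τ₂, p′, σ]` satisfy the conclusions of
Lemma 3.4 for `Transform` run with `Φ = 2^(2M)eps` (`TransformPhiSpec`: `σ = 2ᵏ`, `p′ᵢ ∈ F`, `|p′ᵢ| ≤ epsσ`,
`τ₁ = fl(t + τ) = fl(τ₁ + τ₂)` for the last extraction `t = t⁽ᵐ⁻¹⁾ ∈ F ∩ σℤ`, `τ = τ⁽ᵐ⁾`, `|τ| ≤ n·2⁻ᴹσ < σ`,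
`|τ₂| ≤ eps·ufp(τ₁)`, and the stopping inequality `2^(2M)epsσ ≤ |τ₁|` when `σ > ½eps⁻¹eta`), assume
`σ > ½eps⁻¹eta`, `2^(2M)eps ≤ 1`, `n + 2 ≤ 2ᴹ`, and let `τ₃ ∈ F` with (3.14) `|τ₃| ≤ n·epsσ` (in the algorithm,
`τ₃ = fl(Σ p′ᵢ)`). Put `τ₂′ = fl(τ₂ + τ₃)`, `res = fl(τ₁ + τ₂′)`. Then (6.4) `|τ₂′| ≤ |τ₁|`, so that
`Δ := fl(res − τ₁) = res − τ₁ ∈ F` (Part I, Lemma 2.6), and (6.5) `R̃ := τ₂ − Δ ∈ F`, i.e. `R = fl(τ₂ − Δ) = τ₂ − Δ`;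
moreover `R̃ ∈ 2^(2M)eps·epsσ·ℤ` (the grid form of (6.2), from `res ∈ eps·ufp(τ₁)ℤ`, `τ₁, τ₂ ∈ epsσℤ` and (3.11)
`ufp(τ₁) ≥ 2^(2M)epsσ`).

The source argues by the cases `|τ₁| < σ` ("`τ₂ = 0`, hence `R̃ = −Δ ∈ F`"), `σ ≤ |τ₁| < eps⁻¹σ` via (10.3)
`|R̃| ≤ eps|τ₁| + eps(2 + eps)|τ₂| + (1 + eps)²|τ₃|` ("so `|R̃| < σ` if `|τ₁|` is not too large") and (10.4)
`R̃ ∈ epsσℤ`, (2.5); and `|τ₁| ≥ eps⁻¹σ` via (10.5) `res ∈ {pred(τ₁), τ₁, succ(τ₁)}`, (10.6)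
`sign(τ₂) = sign(τ₂′) = sign(Δ)`, (10.7)–(10.8) and the neighbour analysis (10.10). This formalisation
follows the same case split with the thresholds `|τ₁| < σ`, `σ ≤ |τ₁|` and `eps|τ₁| < (3/5)σ`,
`(3/5)σ ≤ eps|τ₁| < σ`, `σ ≤ eps|τ₁|`; in the last two regimes it uses, in place of the `pred`/`succ`
calculus, the two rounding facts behind (10.5)/(10.6): every `g ∈ F` with `g < τ₁` satisfies `g ≤ res` and
every `g ∈ F` with `g > τ₁` satisfies `res ≤ g` (because `τ₁ = fl(τ₁ + τ₂)` is a nearest rounding, so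
`|τ₂| ≤ ½|g − τ₁|`, and `|τ₂′ − τ₂| < ½eps·ufp(τ₁) ≤ ½|g − τ₁|`), and `Δ ≠ 0 ⟹ sign(τ₂) = sign(Δ)`; the bound
`|τ₂| ≤ |τ⁽ᵐ⁾| ≤ (1 − 2^(1−M))σ` (as `t⁽ᵐ⁻¹⁾ ∈ F` is a rounding candidate for `τ₁ = fl(t⁽ᵐ⁻¹⁾ + τ⁽ᵐ⁾)`) replaces
the source's (10.9). [cite: RumpOgitaOishi2009, Appendix (proof of (6.5)), eqs. (10.1)–(10.10); Lemma 6.3 eqs. (6.4)–(6.5)] -/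
theorem exact_correction_of_transformPhiSpec (hfl : IsRoundNearest p emin fl) {M : ℕ} (hM : 2 ≤ M)
    (h2M : 2 * M ≤ p) {n : ℕ} (hnM : n + 2 ≤ 2 ^ M) {s' τ₁ τ₂ σ : ℚ} {xs' : List ℚ}
    (H : TransformPhiSpec p emin fl M (2 ^ (2 * M) * unitRoundoff p) s' n τ₁ τ₂ xs' σ)
    (hσN : (2 : ℚ) ^ (emin + p - 1) < σ) {τ₃ : ℚ} (hτ₃F : IsFloat p emin τ₃)
    (hτ₃abs : |τ₃| ≤ n * (unitRoundoff p * σ)) :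
    |fl (τ₂ + τ₃)| ≤ |τ₁| ∧
      fl (fl (τ₁ + fl (τ₂ + τ₃)) - τ₁) = fl (τ₁ + fl (τ₂ + τ₃)) - τ₁ ∧
      IsFloat p emin (fl (τ₁ + fl (τ₂ + τ₃)) - τ₁) ∧
      IsFloat p emin (τ₂ - (fl (τ₁ + fl (τ₂ + τ₃)) - τ₁)) ∧
      fl (τ₂ - fl (fl (τ₁ + fl (τ₂ + τ₃)) - τ₁)) = τ₂ - (fl (τ₁ + fl (τ₂ + τ₃)) - τ₁) ∧
      OnGrid (2 ^ (2 * M) * unitRoundoff p * (unitRoundoff p * σ))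
        (τ₂ - (fl (τ₁ + fl (τ₂ + τ₃)) - τ₁)) := by
  have hp : 1 ≤ p := by omega
  obtain ⟨k, hk, hσk⟩ := H.two_zpow
  obtain ⟨t, τ, htF, hτF, htg, hτg, hτle, hnσ, hs, h12, h1, hτ₂le⟩ := H.last
  have hτ₁F := H.isFloat₁
  have hτ₂F := H.isFloat₂
  obtain ⟨hfl12, hτ₁g, hτ₂g⟩ := H.fl_add_eq hp hfl
  have hexit := H.phi_mul_le_ufp hσN
  have hu0 : 0 < unitRoundoff p := u_pos
  set u := unitRoundoff p with hu
  set e := u * σ with he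
  set A := ufp τ₁ with hA
  set T := |τ₁| with hT
  set m : ℚ := (2 : ℚ) ^ M with hm
  have hσ0 : 0 < σ := hσk ▸ two_zpow_pos k
  have he0 : 0 < e := mul_pos hu0 hσ0
  have hm0 : 0 < m := by positivity
  have hm4 : 4 ≤ m := by
    calc (4 : ℚ) = 2 ^ 2 := by norm_num
      _ ≤ 2 ^ M := pow_le_pow_right₀ (by norm_num) hM
  have hnm : (n : ℚ) + 2 ≤ m := by rw [hm]; exact_mod_cast hnM
  have hn0 : (0 : ℚ) ≤ n := Nat.cast_nonneg n
  -- `2^(2M)eps ≤ 1`, i.e. `eps·m² ≤ 1`; hence `eps ≤ 1/16` and `(m − 2)eps ≤ 1/8` (as `8(m − 2) ≤ m²`)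
  have humm : u * (m * m) ≤ 1 := by
    have h1 : (2 : ℚ) ^ (2 * M) ≤ 2 ^ p := pow_le_pow_right₀ (by norm_num) h2M
    have h3 : (0 : ℚ) < 2 ^ p := by positivity
    rw [two_mul, pow_add] at h1
    rw [hu, hm, unitRoundoff, one_div_mul_eq_div, div_le_one h3]
    exact h1
  have hu16 : u ≤ 1 / 16 := by
    have h16 : (16 : ℚ) ≤ m * m := by nlinarith only [hm4]
    have := mul_le_mul_of_nonneg_left h16 hu0.le
    linarith only [this, humm]
  have h8m : 8 * (m - 2) ≤ m * m := by nlinarith only [sq_nonneg (m - 4)]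
  have hm2u : (m - 2) * u ≤ 1 / 8 := by
    have := mul_le_mul_of_nonneg_left h8m hu0.le
    linarith only [this, humm]
  -- `σ = 2ᵏ` with `k ≥ emin + p`; `e = epsσ = 2^(k−p)`
  have hkp : emin + p ≤ k := by
    by_contra hlt
    have : (2 : ℚ) ^ k ≤ (2 : ℚ) ^ (emin + p - 1) := zpow_le_zpow_right₀ (by norm_num) (by omega)
    rw [← hσk] at this
    exact absurd hσN (not_lt.mpr this)
  have hek : e = (2 : ℚ) ^ (k - p) := by rw [he, hσk, hu, u_mul_two_zpow]
  -- (3.11): `A = ufp(τ₁) ≥ m²e > 0`; `τ₁ ≠ 0`; `A = 2ʲ` with `j ≥ k + 2M − p`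
  have hρA : m * m * e ≤ A := by
    have h3 : m * m * e = 2 ^ (2 * M) * unitRoundoff p * σ := by rw [he, hu, hm, two_mul, pow_add]; ring
    rw [h3]; exact hexit
  have hA0 : 0 < A := lt_of_lt_of_le (by positivity) hρA
  have hτ₁0 : τ₁ ≠ 0 := by intro h; rw [hA, h, ufp_zero] at hA0; exact lt_irrefl _ hA0
  have hAT : A ≤ T := ufp_le_abs τ₁
  have hT0 : 0 < T := lt_of_lt_of_le hA0 hAT
  set j : ℤ := Int.log 2 T with hj
  have hAj : A = (2 : ℚ) ^ j := by rw [hA, ufp_of_ne_zero hτ₁0]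
  have hjk : k + 2 * M - p ≤ j := by
    have h := hexit
    rw [hσk, hu, two_pow_mul_u_mul_two_zpow] at h
    have h' : (2 : ℚ) ^ (k + (2 * M : ℕ) - p) ≤ (2 : ℚ) ^ j := by rw [← hAj]; exact h
    have := (zpow_le_zpow_iff_right₀ (by norm_num : (1 : ℚ) < 2)).mp h'
    push_cast at this
    omega
  have hg2 : (2 : ℚ) ^ (j - 1) = A / 2 := by
    rw [hAj, zpow_sub_one₀ (by norm_num : (2 : ℚ) ≠ 0)]; ring
  -- the small terms: `ne ≤ (m − 2)e`, `(m − 2)e ≤ σ/8`, `(m − 2)e ≤ A/8`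
  have hτ₃e : |τ₃| ≤ n * e := hτ₃abs
  have hne_le : (n : ℚ) * e ≤ (m - 2) * e := mul_le_mul_of_nonneg_right (by linarith only [hnm]) he0.le
  have hmeσ : (m - 2) * e ≤ σ / 8 := by
    have : (m - 2) * e = ((m - 2) * u) * σ := by rw [he]; ring
    rw [this]; nlinarith only [hm2u, hσ0]
  have hmeA : (m - 2) * e ≤ A / 8 := by
    have := mul_le_mul_of_nonneg_right h8m he0.le
    linarith only [this, hρA]
  -- `|τ₂| ≤ |τ⁽ᵐ⁾| ≤ n·2⁻ᴹσ ≤ (m − 2)σ/m < σ` (`t⁽ᵐ⁻¹⁾ ∈ F` is a rounding candidate for `τ₁ = fl(t⁽ᵐ⁻¹⁾ + τ⁽ᵐ⁾)`)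
  have hτ₂τ : |τ₂| ≤ |τ| := by
    have h := abs_err_le_abs_operand hfl htF τ
    have : τ₂ = -(fl (t + τ) - (t + τ)) := by rw [← h1, ← h12]; ring
    rw [this, abs_neg]; exact h
  have hτ₂σ' : |τ₂| ≤ (m - 2) * (σ / m) :=
    (hτ₂τ.trans hτle).trans (mul_le_mul_of_nonneg_right (by linarith only [hnm]) (div_nonneg hσ0.le hm0.le))
  have hτ₂σ : |τ₂| < σ := lt_of_le_of_lt (hτ₂τ.trans hτle) hnσ
  -- `τ₂′ = fl(τ₂ + τ₃)`, `res = fl(τ₁ + τ₂′)`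
  set τ₂' := fl (τ₂ + τ₃) with hτ₂'
  set res := fl (τ₁ + τ₂') with hres
  have hτ₂'F : IsFloat p emin τ₂' := (hfl _).1
  have hresF : IsFloat p emin res := (hfl _).1
  -- `B := |τ₂′ − τ₂| ≤ eps|τ₂| + (1 + eps)|τ₃|` (cf. (10.3))
  have hB : |τ₂' - τ₂| ≤ u * |τ₂| + (1 + u) * |τ₃| := by
    have hd₂ : |τ₂' - (τ₂ + τ₃)| ≤ u * |τ₂ + τ₃| :=
      (abs_fl_add_sub_le_u_ufp hp hfl hτ₂F hτ₃F).trans (mul_le_mul_of_nonneg_left (ufp_le_abs _) hu0.le)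
    have h2 : |τ₂ + τ₃| ≤ |τ₂| + |τ₃| := abs_add_le _ _
    have h3 : |τ₂' - τ₂| ≤ |τ₂' - (τ₂ + τ₃)| + |τ₃| := by
      have e1 : τ₂' - τ₂ = (τ₂' - (τ₂ + τ₃)) + τ₃ := by ring
      rw [e1]; exact abs_add_le _ _
    have h4 : u * |τ₂ + τ₃| ≤ u * (|τ₂| + |τ₃|) := mul_le_mul_of_nonneg_left h2 hu0.le
    linarith only [hd₂, h3, h4]
  have hτ₂'le : |τ₂'| ≤ |τ₂| + (u * |τ₂| + (1 + u) * |τ₃|) := by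
    have : |τ₂'| ≤ |τ₂| + |τ₂' - τ₂| := by
      have e1 : τ₂' = τ₂ + (τ₂' - τ₂) := by ring
      calc |τ₂'| = |τ₂ + (τ₂' - τ₂)| := by rw [← e1]
        _ ≤ |τ₂| + |τ₂' - τ₂| := abs_add_le _ _
    linarith only [this, hB]
  -- `B ≤ eps²A + (17/16)(A/8) ≤ (9/64)A` and (6.4): `|τ₂′| ≤ eps·A + B ≤ A/4 ≤ |τ₁|`
  have hBA : u * |τ₂| + (1 + u) * |τ₃| ≤ 9 / 64 * A := by
    have P1 : u * |τ₂| ≤ u * (u * A) := mul_le_mul_of_nonneg_left hτ₂le hu0.le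
    have P2 : u * (u * A) ≤ 1 / 16 * (u * A) := mul_le_mul_of_nonneg_right hu16 (by positivity)
    have P2' : u * A ≤ 1 / 16 * A := mul_le_mul_of_nonneg_right hu16 hA0.le
    have P3 : (1 + u) * |τ₃| ≤ (1 + 1 / 16) * (A / 8) :=
      mul_le_mul (by linarith only [hu16]) ((hτ₃e.trans hne_le).trans hmeA) (abs_nonneg _) (by norm_num)
    linarith only [P1, P2, P2', P3, hA0]
  have hτ₂'A : |τ₂'| ≤ A / 4 := by
    have : |τ₂| ≤ 1 / 16 * A := hτ₂le.trans (mul_le_mul_of_nonneg_right hu16 hA0.le)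
    linarith only [hτ₂'le, hBA, this, hA0]
  have h64 : |τ₂'| ≤ T := by linarith only [hτ₂'A, hAT, hA0]
  -- (6.4): `Δ := fl(res − τ₁) = res − τ₁ ∈ F` (Part I, Lemma 2.6 for `FastTwoSum(τ₁, τ₂′)`)
  have hΔF : IsFloat p emin (res - τ₁) := isFloat_fl_add_sub_left hfl hτ₁F hτ₂'F h64
  have hflΔ : fl (res - τ₁) = res - τ₁ := (fast2Sum_correct hp hfl hτ₁F hτ₂'F h64).1
  set Δ := res - τ₁ with hΔ
  -- `|res| ≥ A/2` (`A/2 ∈ F`, `|τ₁ + τ₂′| ≥ |τ₁| − A/4`), so `res ∈ eps·ufp(τ₁)·ℤ = 2^(j−p)ℤ` ((2.13));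
  -- `τ₁ ∈ 2^(j−p)ℤ`, `τ₁, τ₂ ∈ epsσℤ = 2^(k−p)ℤ` (3.3), hence `R̃ = τ₂ − Δ ∈ 2^(k+2M−2p)ℤ` (the grid of (6.2))
  have hres_ge : A / 2 ≤ |res| := by
    have hgF : IsFloat p emin ((2 : ℚ) ^ (j - 1)) := isFloat_two_zpow hp (by omega)
    have h2 : |(2 : ℚ) ^ (j - 1)| ≤ |τ₁ + τ₂'| := by
      rw [abs_of_pos (two_zpow_pos _), hg2]
      have : T - |τ₂'| ≤ |τ₁ + τ₂'| := by
        have := abs_sub_abs_le_abs_sub τ₁ (-τ₂')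
        rwa [abs_neg, sub_neg_eq_add] at this
      linarith only [this, hτ₂'A, hAT, hA0]
    have := abs_le_abs_fl hfl hgF h2
    rwa [abs_of_pos (two_zpow_pos _), hg2] at this
  have hresg : OnGrid ((2 : ℚ) ^ (j - p)) res := by
    have h := onGrid_of_isFloat_of_le_abs hresF (E := j - 1) (by rw [hg2]; exact hres_ge)
    rwa [show j - 1 - (p : ℤ) + 1 = j - p by ring] at h
  have hτ₁gj : OnGrid ((2 : ℚ) ^ (j - p)) τ₁ :=
    (onGrid_of_isFloat_of_le_abs hτ₁F (E := j) (by rw [← hAj]; exact hAT)).of_le (by omega)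
  have hΔg : OnGrid ((2 : ℚ) ^ (j - p)) Δ := hresg.sub hτ₁gj
  have hτ₂gk : OnGrid ((2 : ℚ) ^ (k - p)) τ₂ := by rw [← hek]; exact hτ₂g
  have hτ₁gk : OnGrid ((2 : ℚ) ^ (k - p)) τ₁ := by rw [← hek]; exact hτ₁g
  have hRg2 : OnGrid (2 ^ (2 * M) * u * e) (τ₂ - Δ) := by
    rw [hek, hu, two_pow_mul_u_mul_two_zpow]
    exact (hτ₂gk.of_le (by push_cast; omega)).sub (hΔg.of_le (by push_cast; omega))
  -- MAIN ((6.5)): `R̃ = τ₂ − Δ ∈ F`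
  have hRF : IsFloat p emin (τ₂ - Δ) := by
    -- "we may assume `res ≠ τ₁` because otherwise `Δ = 0` and `R̃ = τ₂ ∈ F`"
    by_cases hΔ0 : Δ = 0
    · rw [hΔ0, sub_zero]; exact hτ₂F
    have hresne : res ≠ τ₁ := fun h => hΔ0 (by rw [hΔ, h, sub_self])
    -- "First, assume `|τ₁| < σ`. Then … `|τ₂| ≤ eps·ufp(τ₁) ≤ eps|τ₁| < epsσ` and (10.1) yield `τ₂ = 0`.
    --  Hence `R̃ = −Δ ∈ F`."
    by_cases hTσ : T < σ
    · have hτ₂0 : τ₂ = 0 := by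
        by_contra hne
        have h1' : (2 : ℚ) ^ (k - p) ≤ |τ₂| := two_zpow_le_abs_of_onGrid hτ₂gk hne
        have h2' : |τ₂| < e := by
          calc |τ₂| ≤ u * A := hτ₂le
            _ ≤ u * T := mul_le_mul_of_nonneg_left hAT hu0.le
            _ < u * σ := mul_lt_mul_of_pos_left hTσ hu0
        rw [hek] at h2'
        exact absurd h1' (not_le.mpr h2')
      rw [hτ₂0, zero_sub]; exact hΔF.neg
    push Not at hTσ
    -- `σ ≤ |τ₁|`: (10.4) `res, τ₁, τ₂ ∈ epsσℤ`, so `R̃ ∈ epsσℤ`; as `epsσ ≥ eta`, by (10.1)/(2.5) it suffices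
    -- to show `|R̃| ≤ σ`
    have hAσ : σ ≤ A := by rw [hσk]; rw [hσk] at hTσ; exact two_zpow_le_ufp hTσ
    have hresgk : OnGrid ((2 : ℚ) ^ (k - p)) res := by
      have h := onGrid_of_isFloat_of_le_abs hresF (E := k - 1) (by
        rw [zpow_sub_one₀ (by norm_num : (2 : ℚ) ≠ 0), ← hσk]; linarith only [hres_ge, hAσ])
      rwa [show k - 1 - (p : ℤ) + 1 = k - p by ring] at h
    have hRgk : OnGrid ((2 : ℚ) ^ (k - p)) (τ₂ - Δ) := hτ₂gk.sub (hresgk.sub hτ₁gk)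
    suffices hRle : |τ₂ - Δ| ≤ σ by
      refine isFloat_of_onGrid_of_abs_le hp (k := k) ?_ (by rw [← hσk]; exact hRle) ?_
      · rw [u_mul_two_zpow]; exact hRgk
      · rw [u_mul_two_zpow]; exact zpow_le_zpow_right₀ (by norm_num) (by omega)
    -- `res − (τ₁ + τ₂′)` is the rounding error of the last addition: `≤ eps(|τ₁| + |τ₂′|)`
    have hd₁ : |res - (τ₁ + τ₂')| ≤ u * (T + |τ₂'|) := by
      have h := abs_fl_add_sub_le_u_ufp hp hfl hτ₁F hτ₂'F
      have h2 : ufp (τ₁ + τ₂') ≤ T + |τ₂'| := (ufp_le_abs _).trans (abs_add_le _ _)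
      exact h.trans (mul_le_mul_of_nonneg_left h2 hu0.le)
    by_cases h2 : u * T < 3 / 5 * σ
    · -- `σ ≤ |τ₁|`, `eps|τ₁| < (3/5)σ`: (10.2)–(10.3) `|R̃| ≤ eps|τ₁| + eps(2 + eps)|τ₂| + (1 + eps)²|τ₃|`
      --  `≤ (1 + 2eps + eps²)(eps|τ₁| + σ/8) < σ`
      have hR1 : |τ₂ - Δ| ≤ |τ₂' - τ₂| + u * (T + |τ₂'|) := by
        have e1 : τ₂ - Δ = (τ₂ - τ₂') - (res - (τ₁ + τ₂')) := by rw [hΔ]; ring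
        rw [e1]
        calc |τ₂ - τ₂' - (res - (τ₁ + τ₂'))| ≤ |τ₂ - τ₂'| + |res - (τ₁ + τ₂')| := abs_sub _ _
          _ ≤ |τ₂' - τ₂| + u * (T + |τ₂'|) := by rw [abs_sub_comm τ₂ τ₂']; linarith only [hd₁]
      have hX : u * |τ₂| ≤ u * (u * T) :=
        mul_le_mul_of_nonneg_left (hτ₂le.trans (mul_le_mul_of_nonneg_left hAT hu0.le)) hu0.le
      have hX2 : u * (u * |τ₂|) ≤ u * (u * (u * T)) := mul_le_mul_of_nonneg_left hX hu0.le
      have hτ₃σ : |τ₃| ≤ σ / 8 := (hτ₃e.trans hne_le).trans hmeσ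
      have P1 : u * (u * T) ≤ 1 / 16 * (u * T) := mul_le_mul_of_nonneg_right hu16 (by positivity)
      have P2 : u * (u * (u * T)) ≤ 1 / 16 * (u * (u * T)) :=
        mul_le_mul_of_nonneg_right hu16 (by positivity)
      have P5 : u * |τ₂'| ≤ u * (|τ₂| + (u * |τ₂| + (1 + u) * |τ₃|)) :=
        mul_le_mul_of_nonneg_left hτ₂'le hu0.le
      have P7 : u * |τ₃| ≤ 1 / 16 * |τ₃| := mul_le_mul_of_nonneg_right hu16 (abs_nonneg _)
      have P8 : u * (u * |τ₃|) ≤ 1 / 16 * (u * |τ₃|) := mul_le_mul_of_nonneg_right hu16 (by positivity)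
      linarith only [hR1, hB, hX, hX2, hτ₃σ, P1, P2, P5, P7, P8, h2, hσ0]
    · push Not at h2
      -- `(3/5)σ ≤ eps|τ₁|`: `A ≥ ½eps⁻¹σ = 2^(k+p−1)`, `σ ≤ 2eps·A`, and `B ≤ (21/64)eps·A < ½eps·A`
      have hA2 : (2 : ℚ) ^ (k + p - 1) ≤ A := by
        refine two_zpow_le_ufp ?_
        have h3 : u * (2 : ℚ) ^ (k + p - 1) = σ / 2 := by
          rw [hu, u_mul_two_zpow, show k + p - 1 - (p : ℤ) = k - 1 by ring,
            zpow_sub_one₀ (by norm_num : (2 : ℚ) ≠ 0), ← hσk]; ring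
        show (2 : ℚ) ^ (k + p - 1) ≤ T
        by_contra hlt; push Not at hlt
        have : u * T < u * (2 : ℚ) ^ (k + p - 1) := mul_lt_mul_of_pos_left hlt hu0
        rw [h3] at this; linarith only [this, h2, hσ0]
      have hσA : σ ≤ 2 * u * A := by
        have h4 : 2 * u * (2 : ℚ) ^ (k + p - 1) = σ := by
          rw [hu, two_mul_u_mul_two_zpow, show k + p - 1 - (p : ℤ) + 1 = k by ring, ← hσk]
        have := mul_le_mul_of_nonneg_left hA2 (by positivity : (0 : ℚ) ≤ 2 * u)
        rw [h4] at this; exact this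
      have hBuA : u * |τ₂| + (1 + u) * |τ₃| ≤ 21 / 64 * (u * A) := by
        have P1 : u * |τ₂| ≤ u * (u * A) := mul_le_mul_of_nonneg_left hτ₂le hu0.le
        have P2 : u * (u * A) ≤ 1 / 16 * (u * A) := mul_le_mul_of_nonneg_right hu16 (by positivity)
        have P3 : |τ₃| ≤ ((m - 2) * u) * σ := by
          have := hτ₃e.trans hne_le; rw [he] at this; linarith only [this]
        have P4 : ((m - 2) * u) * σ ≤ 1 / 8 * (2 * u * A) := mul_le_mul hm2u hσA hσ0.le (by norm_num)
        have P5 : (1 + u) * |τ₃| ≤ (1 + 1 / 16) * (1 / 8 * (2 * u * A)) :=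
          mul_le_mul (by linarith only [hu16]) (P3.trans P4) (abs_nonneg _) (by norm_num)
        linarith only [P1, P2, P5]
      have huA0 : 0 < u * A := mul_pos hu0 hA0
      have hBlt : |τ₂' - τ₂| < u * A / 2 := by linarith only [hB, hBuA, huA0]
      -- (10.5)/(10.6), as rounding facts: floats below `τ₁` are `≤ res`, floats above `τ₁` are `≥ res`
      -- (`τ₁ = fl(τ₁ + τ₂)` nearest: `|τ₂| ≤ ½|g − τ₁|`; `|g − τ₁| ≥ eps·ufp(τ₁) > 2B`), and `sign(τ₂) = sign(Δ)`
      have hlow : ∀ g : ℚ, IsFloat p emin g → g < τ₁ → g ≤ res := by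
        intro g hgF hgt
        have hd : u * A ≤ τ₁ - g := by
          have := u_mul_ufp_le_abs_sub hp hτ₁F hgF hgt.ne
          rwa [abs_sub_comm, abs_of_pos (sub_pos.mpr hgt)] at this
        have hnear := (hfl (t + τ)).2 g hgF
        rw [← h1, ← h12, show τ₁ + τ₂ - τ₁ = τ₂ by ring] at hnear
        have hτ₂ge : -(τ₁ - g) / 2 ≤ τ₂ := by
          by_contra hlt; push Not at hlt
          have hτ₂neg : τ₂ < 0 := by linarith only [hlt, hd, huA0]
          rw [abs_of_neg hτ₂neg] at hnear
          rcases le_or_gt 0 (τ₁ + τ₂ - g) with hc | hc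
          · rw [abs_of_nonneg hc] at hnear; linarith only [hnear, hlt]
          · rw [abs_of_neg hc] at hnear; linarith only [hnear, hd, huA0]
        have hge : g ≤ τ₁ + τ₂' := by
          have : τ₂ - |τ₂' - τ₂| ≤ τ₂' := by have := neg_abs_le (τ₂' - τ₂); linarith only [this]
          linarith only [this, hBlt, hτ₂ge, hd]
        exact le_fl_of_le hfl hgF hge
      have hhigh : ∀ g : ℚ, IsFloat p emin g → τ₁ < g → res ≤ g := by
        intro g hgF hgt
        have hd : u * A ≤ g - τ₁ := by
          have := u_mul_ufp_le_abs_sub hp hτ₁F hgF hgt.ne'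
          rwa [abs_of_pos (sub_pos.mpr hgt)] at this
        have hnear := (hfl (t + τ)).2 g hgF
        rw [← h1, ← h12, show τ₁ + τ₂ - τ₁ = τ₂ by ring] at hnear
        have hτ₂le' : τ₂ ≤ (g - τ₁) / 2 := by
          by_contra hlt; push Not at hlt
          have hτ₂pos : 0 < τ₂ := by linarith only [hlt, hd, huA0]
          rw [abs_of_pos hτ₂pos] at hnear
          rcases le_or_gt 0 (τ₁ + τ₂ - g) with hc | hc
          · rw [abs_of_nonneg hc] at hnear; linarith only [hnear, hd, huA0]
          · rw [abs_of_neg hc] at hnear; linarith only [hnear, hlt]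
        have hle : τ₁ + τ₂' ≤ g := by
          have : τ₂' ≤ τ₂ + |τ₂' - τ₂| := by have := le_abs_self (τ₂' - τ₂); linarith only [this]
          linarith only [this, hBlt, hτ₂le', hd]
        exact fl_le_of_le hfl hgF hle
      have huAΔ : u * A ≤ |Δ| := u_mul_ufp_le_abs_sub hp hτ₁F hresF hresne
      have hsign_pos : 0 < Δ → 0 < τ₂ := by
        intro hΔpos
        have hd : u * A ≤ Δ := by rwa [abs_of_pos hΔpos] at huAΔ
        have hnear := (hfl (τ₁ + τ₂')).2 τ₁ hτ₁F
        rw [show τ₁ + τ₂' - τ₁ = τ₂' by ring] at hnear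
        have hnear' : |τ₁ + τ₂' - res| ≤ |τ₂'| := hnear
        have hτ₂'ge : Δ / 2 ≤ τ₂' := by
          by_contra hlt; push Not at hlt
          have hc : τ₁ + τ₂' - res < 0 := by linarith only [hlt, hΔpos, hΔ]
          rw [abs_of_neg hc] at hnear'
          rcases le_or_gt 0 τ₂' with hc2 | hc2
          · rw [abs_of_nonneg hc2] at hnear'; linarith only [hnear', hlt, hΔ]
          · rw [abs_of_neg hc2] at hnear'; linarith only [hnear', hΔpos, hΔ]
        have : τ₂' - |τ₂' - τ₂| ≤ τ₂ := by have := le_abs_self (τ₂' - τ₂); linarith only [this]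
        linarith only [this, hBlt, hτ₂'ge, hd]
      have hsign_neg : Δ < 0 → τ₂ < 0 := by
        intro hΔneg
        have hd : u * A ≤ -Δ := by rwa [abs_of_neg hΔneg] at huAΔ
        have hnear := (hfl (τ₁ + τ₂')).2 τ₁ hτ₁F
        rw [show τ₁ + τ₂' - τ₁ = τ₂' by ring] at hnear
        have hnear' : |τ₁ + τ₂' - res| ≤ |τ₂'| := hnear
        have hτ₂'le' : τ₂' ≤ Δ / 2 := by
          by_contra hlt; push Not at hlt
          have hc : 0 < τ₁ + τ₂' - res := by linarith only [hlt, hΔneg, hΔ]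
          rw [abs_of_pos hc] at hnear'
          rcases le_or_gt 0 τ₂' with hc2 | hc2
          · rw [abs_of_nonneg hc2] at hnear'; linarith only [hnear', hΔneg, hΔ]
          · rw [abs_of_neg hc2] at hnear'; linarith only [hnear', hlt, hΔ]
        have : τ₂ ≤ τ₂' + |τ₂' - τ₂| := by have := neg_abs_le (τ₂' - τ₂); linarith only [this]
        linarith only [this, hBlt, hτ₂'le', hd]
      -- it suffices to show `|Δ| ≤ σ`: then `τ₂Δ > 0` and `|τ₂| < σ` give `|τ₂ − Δ| ≤ σ`
      suffices hΔσ : |Δ| ≤ σ by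
        have hτ₂b := abs_lt.mp hτ₂σ
        have hΔb := abs_le.mp hΔσ
        rw [abs_le]
        rcases lt_or_gt_of_ne hΔ0 with hneg | hpos
        · have := hsign_neg hneg; constructor <;> linarith only [this, hneg, hτ₂b.1, hτ₂b.2, hΔb.1, hΔb.2]
        · have := hsign_pos hpos; constructor <;> linarith only [this, hpos, hτ₂b.1, hτ₂b.2, hΔb.1, hΔb.2]
      by_cases h3 : u * T < σ
      · -- `(3/5)σ ≤ eps|τ₁| < σ`: `ufp(τ₁) = ½eps⁻¹σ`, `τ₁ ∓ σ = τ₁ ∓ 2eps·ufp(τ₁) ∈ F`, hence `|Δ| ≤ σ`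
        have hTlt : T < (2 : ℚ) ^ (k + p) := by
          have h4 : u * (2 : ℚ) ^ (k + p) = σ := by
            rw [hu, u_mul_two_zpow, show k + p - (p : ℤ) = k by ring, ← hσk]
          by_contra hle; push Not at hle
          have := mul_le_mul_of_nonneg_left hle hu0.le
          rw [h4] at this; linarith only [this, h3]
        have hAeq : A = (2 : ℚ) ^ (k + p - 1) :=
          le_antisymm (ufp_le_two_zpow_of_abs_lt (by rw [show k + p - 1 + 1 = k + p by ring]; exact hTlt)) hA2
        have h2uA : 2 * unitRoundoff p * ufp τ₁ = σ := by
          rw [← hA, hAeq, two_mul_u_mul_two_zpow, show k + p - 1 - (p : ℤ) + 1 = k by ring, ← hσk]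
        have hU : (2 : ℚ) ^ (emin + p - 1) < |τ₁| := lt_of_lt_of_le hσN hTσ
        have hg₁ : IsFloat p emin (τ₁ - σ) := by
          have h := isFloat_add_two_u_ufp_of_not_mem_U hp hτ₁F hU (-1) (by norm_num)
          rw [h2uA] at h; push_cast at h
          have e1 : τ₁ + -1 * σ = τ₁ - σ := by ring
          rwa [e1] at h
        have hg₂ : IsFloat p emin (τ₁ + σ) := by
          have h := isFloat_add_two_u_ufp_of_not_mem_U hp hτ₁F hU 1 (by norm_num)
          rw [h2uA] at h; push_cast at h
          rwa [one_mul] at h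
        have hl := hlow _ hg₁ (by linarith only [hσ0])
        have hh := hhigh _ hg₂ (by linarith only [hσ0])
        rw [hΔ, abs_le]; constructor <;> linarith only [hl, hh]
      · push Not at h3
        -- `σ ≤ eps|τ₁|`: `A ≥ eps⁻¹σ = 2^(k+p)`, so `eps·A ≥ σ`
        have hT4 : (2 : ℚ) ^ (k + p) ≤ T := by
          have h4 : u * (2 : ℚ) ^ (k + p) = σ := by
            rw [hu, u_mul_two_zpow, show k + p - (p : ℤ) = k by ring, ← hσk]
          by_contra hlt; push Not at hlt
          have := mul_lt_mul_of_pos_left hlt hu0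
          rw [h4] at this; linarith only [this, h3]
        have hA4 : (2 : ℚ) ^ (k + p) ≤ A := two_zpow_le_ufp hT4
        -- `|τ₂′| < σ`: `m|τ₂′| ≤ m(|τ₂| + B) ≤ (m − 2)σ + (eps·m)σ + (1 + eps)(m − 2)(eps·m)σ < mσ`
        have hτ₂'σ : |τ₂'| < σ := by
          have hum0 : 0 ≤ u * m := by positivity
          have Q1 : u * m ≤ 1 / 4 := by
            have : u * m * 4 ≤ u * m * m := mul_le_mul_of_nonneg_left hm4 hum0
            linarith only [this, humm]
          have V1 : (m - 2) * (u * m) ≤ 1 := by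
            have : (m - 2) * (u * m) ≤ m * (u * m) :=
              mul_le_mul_of_nonneg_right (by linarith only [hm4]) hum0
            linarith only [this, humm]
          have V0 : 0 ≤ (m - 2) * (u * m) := mul_nonneg (by linarith only [hm4]) hum0
          have V2 : (1 + u) * ((m - 2) * (u * m)) ≤ (1 + 1 / 16) * 1 :=
            mul_le_mul (by linarith only [hu16]) V1 V0 (by norm_num)
          have W1 : m * |τ₂'| ≤ m * (|τ₂| + (u * |τ₂| + (1 + u) * |τ₃|)) :=
            mul_le_mul_of_nonneg_left hτ₂'le hm0.le
          have W2 : m * |τ₂| ≤ (m - 2) * σ := by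
            have := mul_le_mul_of_nonneg_left hτ₂σ' hm0.le
            have e1 : m * ((m - 2) * (σ / m)) = (m - 2) * σ := by field_simp
            linarith only [this, e1]
          have W3 : (u * m) * |τ₂| ≤ (u * m) * σ := mul_le_mul_of_nonneg_left hτ₂σ.le hum0
          have P3 : |τ₃| ≤ ((m - 2) * u) * σ := by
            have := hτ₃e.trans hne_le; rw [he] at this; linarith only [this]
          have W4 : (m * (1 + u)) * |τ₃| ≤ (m * (1 + u)) * (((m - 2) * u) * σ) :=
            mul_le_mul_of_nonneg_left P3 (by positivity)
          have W5 : u * m * σ ≤ 1 / 4 * σ := mul_le_mul_of_nonneg_right Q1 hσ0.le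
          have W6 : (1 + u) * ((m - 2) * (u * m)) * σ ≤ (1 + 1 / 16) * 1 * σ :=
            mul_le_mul_of_nonneg_right V2 hσ0.le
          have W : m * |τ₂'| < m * σ := by linarith only [W1, W2, W3, W4, W5, W6, hσ0]
          exact lt_of_mul_lt_mul_left W hm0.le
        -- `eps·A ≤ |Δ| ≤ 2|τ₂′| < 2σ`, hence `A = eps⁻¹σ = 2^(k+p)` and `eps·A = σ`
        have hΔ2 : |Δ| < 2 * σ := by
          have hnear : |res - (τ₁ + τ₂')| ≤ |τ₂'| := abs_err_le_abs_operand hfl hτ₁F τ₂'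
          have : |Δ| ≤ |res - (τ₁ + τ₂')| + |τ₂'| := by
            have e1 : Δ = (res - (τ₁ + τ₂')) + τ₂' := by rw [hΔ]; ring
            rw [e1]; exact abs_add_le _ _
          linarith only [this, hnear, hτ₂'σ]
        have hjle : j ≤ k + p := by
          have e1 : u * A = (2 : ℚ) ^ (j - p) := by rw [hAj, hu, u_mul_two_zpow]
          have e2 : 2 * σ = (2 : ℚ) ^ (k + 1) := by rw [hσk, zpow_add_one₀ (by norm_num : (2 : ℚ) ≠ 0)]; ring
          have h5 : (2 : ℚ) ^ (j - p) < (2 : ℚ) ^ (k + 1) := by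
            rw [← e1, ← e2]; linarith only [huAΔ, hΔ2]
          have := (zpow_lt_zpow_iff_right₀ (by norm_num : (1 : ℚ) < 2)).mp h5
          omega
        have hAeq : A = (2 : ℚ) ^ (k + p) :=
          le_antisymm (by rw [hAj]; exact zpow_le_zpow_right₀ (by norm_num) hjle) hA4
        have huAσ : u * A = σ := by rw [hAeq, hu, u_mul_two_zpow, show k + p - (p : ℤ) = k by ring, ← hσk]
        -- `|res| < A` (else `res, τ₁ ∈ 2σℤ` and `0 < |Δ| < 2σ` is impossible), so `|res| ≤ A − σ` ((2.15))
        have hres_lt : |res| < A := by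
          by_contra hle; push Not at hle
          have hg1 : OnGrid ((2 : ℚ) ^ (k + 1)) res := by
            have h := onGrid_of_isFloat_of_le_abs hresF (E := k + p) (by rw [← hAeq]; exact hle)
            rwa [show k + p - (p : ℤ) + 1 = k + 1 by ring] at h
          have hg2' : OnGrid ((2 : ℚ) ^ (k + 1)) τ₁ := by
            have h := onGrid_of_isFloat_of_le_abs hτ₁F (E := k + p) hT4
            rwa [show k + p - (p : ℤ) + 1 = k + 1 by ring] at h
          have h6 : (2 : ℚ) ^ (k + 1) ≤ |Δ| := two_zpow_le_abs_of_onGrid (hg1.sub hg2') hΔ0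
          rw [zpow_add_one₀ (by norm_num : (2 : ℚ) ≠ 0), ← hσk] at h6
          linarith only [h6, hΔ2]
        have hres_le : |res| ≤ A - σ := by
          have h := abs_le_sub_of_abs_lt_two_zpow hp hresF (E := k + p) (by rw [← hAeq]; exact hres_lt)
          rwa [show k + p - (p : ℤ) = k by ring, ← hσk, ← hAeq] at h
        -- `|τ₁| = A`: `|τ₁| − |res| ≤ |Δ| < 2σ` gives `|τ₁| < A + σ`, and `|τ₁|, A ∈ 2σℤ`
        have hTA : T = A := by
          have h7 : T - |res| ≤ |Δ| := by
            have := abs_sub_abs_le_abs_sub τ₁ res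
            rwa [abs_sub_comm τ₁ res] at this
          have hTlt : T < A + σ := by linarith only [h7, hΔ2, hres_le]
          by_contra hne
          have hgT : OnGrid ((2 : ℚ) ^ (k + 1)) T := by
            have h := onGrid_of_isFloat_of_le_abs hτ₁F (E := k + p) hT4
            rw [show k + p - (p : ℤ) + 1 = k + 1 by ring] at h
            rcases le_or_gt 0 τ₁ with h0 | h0
            · rw [hT, abs_of_nonneg h0]; exact h
            · rw [hT, abs_of_neg h0]; exact h.neg
          have hgA : OnGrid ((2 : ℚ) ^ (k + 1)) A := by
            rw [hAeq]; exact (onGrid_self _).of_le (by omega)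
          have h8 : (2 : ℚ) ^ (k + 1) ≤ |T - A| :=
            two_zpow_le_abs_of_onGrid (hgT.sub hgA) (sub_ne_zero.mpr hne)
          rw [abs_of_nonneg (by linarith only [hAT]), zpow_add_one₀ (by norm_num : (2 : ℚ) ≠ 0), ← hσk] at h8
          linarith only [h8, hTlt, hσ0]
        -- (10.10): the neighbour `sign(τ₁)(A − σ) = sign(τ₁)(1 − eps)eps⁻¹σ ∈ F` of `τ₁` on the side of `res`
        -- forces `|res| = A − σ`, i.e. `|Δ| = σ`
        have hgF : IsFloat p emin ((2 : ℚ) ^ (k + p) - (2 : ℚ) ^ k) := by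
          have h1' : (1 : ℤ) ≤ 2 ^ p := one_le_pow₀ (by norm_num)
          have h := isFloat_of_int_mul (p := p) (emin := emin) (2 ^ p - 1) k
            (by rw [abs_of_nonneg (by omega)]; omega) (by omega)
          have e1 : (((2 : ℤ) ^ p - 1 : ℤ) : ℚ) * (2 : ℚ) ^ k = (2 : ℚ) ^ (k + p) - (2 : ℚ) ^ k := by
            push_cast
            rw [zpow_add₀ (by norm_num : (2 : ℚ) ≠ 0), zpow_natCast]; ring
          rwa [e1] at h
        rcases lt_or_gt_of_ne hτ₁0 with hneg | hpos
        · have hτ₁eq : τ₁ = -A := by rw [← hTA, hT, abs_of_neg hneg]; ring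
          have hle := hhigh (-((2 : ℚ) ^ (k + p) - (2 : ℚ) ^ k)) hgF.neg
            (by rw [hτ₁eq, hAeq, ← hσk]; linarith only [hσ0])
          rw [← hAeq, ← hσk] at hle
          have hres' := (abs_le.mp hres_le).1
          have hreseq : res = -(A - σ) := le_antisymm hle (by linarith only [hres'])
          rw [hΔ, hreseq, hτ₁eq, abs_le]; constructor <;> linarith only [hσ0]
        · have hτ₁eq : τ₁ = A := by rw [← hTA, hT, abs_of_pos hpos]
          have hle := hlow ((2 : ℚ) ^ (k + p) - (2 : ℚ) ^ k) hgF
            (by rw [hτ₁eq, hAeq, ← hσk]; linarith only [hσ0])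
          rw [← hAeq, ← hσk] at hle
          have hres' := (abs_le.mp hres_le).2
          have hreseq : res = A - σ := le_antisymm hres' hle
          rw [hΔ, hreseq, hτ₁eq, abs_le]; constructor <;> linarith only [hσ0]
  have hflR : fl (τ₂ - Δ) = τ₂ - Δ := fl_eq_self hfl hRF
  refine ⟨h64, hflΔ, hΔF, hRF, ?_, hRg2⟩
  rw [hflΔ]; exact hflR

/-! ### §6, Lemma 6.3: `[res, R, p′] = TransformK(p, ϱ)` is error-free -/

/-- `fl(Σ pᵢ)` (recursive summation) is a floating-point number for `pᵢ ∈ F` (each partial sum is a rounded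
value). [cite: RumpOgitaOishi2009, Lemma 3.5 eq. (3.7) (`τ₃ = fl(Σ p′ᵢ) ∈ F`)] -/
theorem isFloat_flSum (hfl : IsRoundNearest p emin fl) {xs : List ℚ} (hxs : ∀ x ∈ xs, IsFloat p emin x) :
    IsFloat p emin (flSum fl xs) := by
  by_cases hnil : xs = []
  · rw [hnil]; exact isFloat_zero p emin
  · obtain ⟨t, ht, hft⟩ := exists_tree_flSum fl hnil
    rw [hft]; exact isFloat_eval hfl t (fun a ha => hxs a (ht ▸ ha))

/-- **LEMMA 6.3.** Let `p` be a vector of `n` floating-point numbers, `M := ⌈log₂(n + 2)⌉`, `2^(2M)eps ≤ 1`,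
`ϱ ∈ F ∩ epsσ₀ℤ` (the hypotheses of Lemma 3.5 on the offset — the grid condition is only required for nonzero `p`;
in `AccSumK` the offset is `0` or the previous `R`, cf. (6.2)),
and let `[res, R, p′] = TransformK(p, ϱ)` (Algorithm 6.2). Then `res` is a faithful rounding of `s + ϱ`, `s = Σ pᵢ`, and
(6.1) `s + ϱ − res = R + Σ p′ᵢ`. "If `res = 0`, then `res = s + ϱ` and `R` and all `p′ᵢ` are zero." `R ∈ F`, `p′ᵢ ∈ F`,
and, if `p′` is nonzero, (6.2) `R ∈ epsσ′ℤ` for the `σ′ = 2^(M + ⌈log₂ μ′⌉)`, `μ′ = max |p′ᵢ|`, of `Transform(p′, ·)` —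
i.e. `R` is an admissible offset for the next cascade step. Furthermore no rounding errors occur in the computation of
`R`: with `[τ₁, τ₂, p′, σ] = Transform(p, ϱ)`, (6.3) `Δ := fl(res − τ₁) = res − τ₁` and `R = fl(τ₂ − Δ) = τ₂ − Δ`.
(For the zero vector, excluded in the source's standing assumption, `TransformK(p, ϱ) = [ϱ, 0, p]` and everything is
immediate.) Proof as in the source: Lemma 3.5; the case `σ ≤ ½eps⁻¹eta` (`p′ = 0`, `s + ϱ = τ₁ + τ₂`, `res = τ₁`,
`R = τ₂`); otherwise (6.4) by (3.15) and Part I Lemma 2.6, (6.5) by the Appendix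
(`exact_correction_of_transformPhiSpec`), and (6.2) from `res ∈ eps·ufp(τ₁)ℤ`, `τ₁, τ₂ ∈ epsσℤ`, (3.11) and
`epsσ′ ≤ 2ᴹeps²σ` ((3.8): `μ′ ≤ epsσ`). [cite: RumpOgitaOishi2009, Lemma 6.3 eqs. (6.1)–(6.5)] -/
theorem transformK_spec (hfl : IsRoundNearest p emin fl) {xs : List ℚ}
    (hxs : ∀ x ∈ xs, IsFloat p emin x) (h2M : 2 * Nat.clog 2 (xs.length + 2) ≤ p) {ϱ : ℚ}
    (hϱ : IsFloat p emin ϱ)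
    (hϱg : maxAbs xs ≠ 0 →
      OnGrid (unitRoundoff p * (2 : ℚ) ^ ((Nat.clog 2 (xs.length + 2) : ℤ) + Int.clog 2 (maxAbs xs))) ϱ) :
    let res := (transformK fl p emin xs ϱ).1
    let R := (transformK fl p emin xs ϱ).2.1
    let xs' := (transformK fl p emin xs ϱ).2.2
    let τ₁ := (transformPhi fl p emin (2 ^ (2 * Nat.clog 2 (xs.length + 2)) * unitRoundoff p) xs ϱ).1
    let τ₂ := (transformPhi fl p emin (2 ^ (2 * Nat.clog 2 (xs.length + 2)) * unitRoundoff p) xs ϱ).2.1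
    IsFaithfulRounding p emin res (xs.sum + ϱ) ∧
      xs.sum + ϱ - res = R + xs'.sum ∧
      (res = 0 → xs.sum + ϱ = 0 ∧ R = 0 ∧ ∀ x ∈ xs', x = 0) ∧
      IsFloat p emin R ∧ (∀ x ∈ xs', IsFloat p emin x) ∧ xs'.length = xs.length ∧
      (maxAbs xs' ≠ 0 →
        OnGrid (unitRoundoff p * (2 : ℚ) ^ ((Nat.clog 2 (xs'.length + 2) : ℤ) + Int.clog 2 (maxAbs xs'))) R) ∧
      fl (res - τ₁) = res - τ₁ ∧ R = τ₂ - (res - τ₁) := by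
  intro res R xs' τ₁ τ₂
  by_cases hμ : maxAbs xs = 0
  · -- the zero vector: `TransformK(p, ϱ) = [ϱ, 0, p]`, `τ₁ = ϱ`, `τ₂ = 0`
    have hK := transformK_of_maxAbs_eq_zero hfl hμ hϱ
    have hT := transformPhi_of_maxAbs_eq_zero fl p emin
      (2 ^ (2 * Nat.clog 2 (xs.length + 2)) * unitRoundoff p) ϱ hμ
    have hres : res = ϱ := by show (transformK fl p emin xs ϱ).1 = ϱ; rw [hK]
    have hR : R = 0 := by show (transformK fl p emin xs ϱ).2.1 = 0; rw [hK]
    have hxs' : xs' = xs := by show (transformK fl p emin xs ϱ).2.2 = xs; rw [hK]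
    have hτ₁ : τ₁ = ϱ := by
      show (transformPhi fl p emin (2 ^ (2 * Nat.clog 2 (xs.length + 2)) * unitRoundoff p) xs ϱ).1 = ϱ
      rw [hT]
    have hτ₂ : τ₂ = 0 := by
      show (transformPhi fl p emin (2 ^ (2 * Nat.clog 2 (xs.length + 2)) * unitRoundoff p) xs ϱ).2.1 = 0
      rw [hT]
    have hz := maxAbs_eq_zero_iff.mp hμ
    have hsum : xs.sum = 0 := List.sum_eq_zero hz
    refine ⟨?_, ?_, ?_, ?_, ?_, ?_, ?_, ?_, ?_⟩
    · rw [hres, hsum, zero_add]; exact isFaithfulRounding_self hϱ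
    · rw [hres, hR, hxs', hsum]; ring
    · intro h
      exact ⟨by rw [hsum, zero_add, ← hres, h], hR, by rw [hxs']; exact hz⟩
    · rw [hR]; exact isFloat_zero p emin
    · rw [hxs']; exact hxs
    · rw [hxs']
    · intro h; rw [hxs'] at h; exact absurd hμ h
    · rw [hres, hτ₁, sub_self]; exact fl_zero hfl
    · rw [hR, hτ₂, hres, hτ₁, sub_self, sub_zero]
  · -- nonzero vector: Lemma 3.4/3.5 (`transformPhi_spec`), then the two cases on `σ`
    have hnil : xs ≠ [] := by rintro rfl; exact hμ rfl
    have hM : 2 ≤ Nat.clog 2 (xs.length + 2) := two_le_clog_length_add_two hnil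
    have hp : 1 ≤ p := by omega
    have hnM : xs.length + 2 ≤ 2 ^ Nat.clog 2 (xs.length + 2) := Nat.le_pow_clog (by norm_num) _
    have H := transformPhi_spec hp hfl hxs hμ (by omega) h2M hϱ (hϱg hμ)
    have hfaith : IsFaithfulRounding p emin res (xs.sum + ϱ) :=
      (accSumOffset_spec_of_maxAbs_ne_zero hfl hxs hμ h2M hϱ (hϱg hμ)).1
    have hzero : res = 0 → τ₁ = 0 ∧ τ₂ = 0 ∧ (∀ x ∈ xs', x = 0) ∧ xs.sum + ϱ = 0 :=
      (accSumOffset_spec_of_maxAbs_ne_zero hfl hxs hμ h2M hϱ (hϱg hμ)).2.1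
    obtain ⟨k, hk, hσk⟩ := H.two_zpow
    have hlen : xs'.length = xs.length := H.length_eq
    have hxs'F : ∀ x ∈ xs', IsFloat p emin x := fun x hx => (H.low x hx).1
    obtain ⟨t, τ, -, -, -, -, -, -, hs, h12, -, -⟩ := H.last
    have h38 : xs.sum + ϱ = τ₁ + τ₂ + xs'.sum := by rw [hs, ← h12]; rfl
    have hRdef : R = fl (τ₂ - fl (res - τ₁)) := rfl
    by_cases hσ : (2 : ℚ) ^ (emin + p - 1) <
        (transformPhi fl p emin (2 ^ (2 * Nat.clog 2 (xs.length + 2)) * unitRoundoff p) xs ϱ).2.2.2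
    · -- `σ > ½eps⁻¹eta`: the Appendix
      have hτ₃F : IsFloat p emin (flSum fl xs') := isFloat_flSum hfl hxs'F
      have hτ₃abs := (accSumOffset_estimates hfl hxs hμ h2M hϱ (hϱg hμ) hσ).1
      obtain ⟨-, hflΔ, -, hRF, hflR, hRg⟩ :=
        exact_correction_of_transformPhiSpec hfl hM h2M hnM H hσ hτ₃F hτ₃abs
      have hflΔ' : fl (res - τ₁) = res - τ₁ := hflΔ
      have hReq : R = τ₂ - (res - τ₁) := hflR
      have hRF' : IsFloat p emin R := by rw [hReq]; exact hRF
      refine ⟨hfaith, ?_, ?_, hRF', hxs'F, hlen, ?_, hflΔ', hReq⟩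
      · rw [hReq, h38]; ring
      · intro h0
        obtain ⟨h₁, h₂, h₃, h₄⟩ := hzero h0
        have h₁' : τ₁ = 0 := h₁
        have h₂' : τ₂ = 0 := h₂
        exact ⟨h₄, by rw [hReq, h0, h₁', h₂']; ring, h₃⟩
      · -- (6.2): `R ∈ 2^(2M)eps·epsσ·ℤ ⊆ epsσ′ℤ` since `μ′ ≤ epsσ = 2^(k−p)` gives `⌈log₂ μ′⌉ ≤ k − p`
        intro hμ'
        have hRg' : OnGrid ((2 : ℚ) ^ (k - p + (2 * Nat.clog 2 (xs.length + 2) : ℕ) - p)) R := by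
          have h := hRg
          rw [hσk, u_mul_two_zpow, two_pow_mul_u_mul_two_zpow] at h
          rw [hReq]; exact h
        obtain ⟨x, hx, hxμ⟩ := exists_abs_eq_maxAbs hμ'
        have hx0 : x ≠ 0 := by intro h; rw [h, abs_zero] at hxμ; exact hμ' hxμ.symm
        have hμ'le : maxAbs xs' ≤ (2 : ℚ) ^ (k - p) := by
          rw [← hxμ]; have := (H.low x hx).2; rwa [hσk, u_mul_two_zpow] at this
        have hμ'pos : 0 < maxAbs xs' := lt_of_le_of_ne (maxAbs_nonneg _) (Ne.symm hμ')
        have hclog : Int.clog 2 (maxAbs xs') ≤ k - p := by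
          have h1 := Int.clog_mono_right (b := 2) hμ'pos hμ'le
          have h2 : Int.clog 2 ((2 : ℚ) ^ (k - p)) = k - p := by
            have := Int.clog_zpow (R := ℚ) (b := 2) (by norm_num) (k - p); exact_mod_cast this
          rwa [h2] at h1
        rw [hlen, u_mul_two_zpow]
        exact hRg'.of_le (by push_cast; omega)
    · -- `σ ≤ ½eps⁻¹eta`: `p′ = 0`, `s + ϱ = τ₁ + τ₂`, `res = fl(τ₁ + τ₂) = τ₁`, `R = τ₂`
      push Not at hσ
      obtain ⟨hz, hsτ⟩ := H.eq_zero_of_le hσ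
      obtain ⟨hfl12, -, -⟩ := H.fl_add_eq hp hfl
      have hz' : ∀ x ∈ xs', x = 0 := hz
      have hres : res = τ₁ := by
        show fl (τ₁ + fl (τ₂ + flSum fl xs')) = τ₁
        rw [flSum_eq_zero hfl hz', add_zero, fl_eq_self hfl H.isFloat₂]; exact hfl12
      have hΔ : fl (res - τ₁) = res - τ₁ := by rw [hres, sub_self]; exact fl_zero hfl
      have hReq : R = τ₂ := by
        rw [hRdef, hΔ, hres, sub_self, sub_zero]; exact fl_eq_self hfl H.isFloat₂
      have hsum' : xs'.sum = 0 := List.sum_eq_zero hz'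
      refine ⟨hfaith, ?_, ?_, ?_, hxs'F, hlen, ?_, hΔ, ?_⟩
      · rw [hReq, h38, hres, hsum']; ring
      · intro h0
        obtain ⟨-, h₂, h₃, h₄⟩ := hzero h0
        have h₂' : τ₂ = 0 := h₂
        exact ⟨h₄, by rw [hReq, h₂'], h₃⟩
      · rw [hReq]; exact H.isFloat₂
      · intro hμ'; exact absurd (maxAbs_eq_zero_iff.mpr hz') hμ'
      · rw [hReq, hres, sub_self, sub_zero]

/-! ### §6, Algorithm 6.4 `AccSumK` and Proposition 6.5 -/

/-- **ALGORITHM 6.4 (`AccSumK`), the `for` loop** on the state `(p⁽ᵏ⁻¹⁾, R_{k−1})` with the number of remaining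
steps: a step computes `[Res_k, R_k, p⁽ᵏ⁾] = TransformK(p⁽ᵏ⁻¹⁾, R_{k−1})`, and "if `Res_k ∈ U`" — `|Res_k| ≤ ½eps⁻¹eta`,
(2.1) — sets `Res_{k+1..K} = 0` and returns. The value is the list of results `Res_k, …, Res_K` of the remaining
steps together with the state `(R, p)` at termination (at a `return`, the state `(R_k, p⁽ᵏ⁾)` of the exit step;
it enters (6.6)). [cite: RumpOgitaOishi2009, Algorithm 6.4] -/
def accSumKAux (fl : ℚ → ℚ) (p : ℕ) (emin : ℤ) : ℕ → List ℚ → ℚ → List ℚ × ℚ × List ℚ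
  | 0, xs, R => ([], R, xs)
  | K + 1, xs, R =>
      if |(transformK fl p emin xs R).1| ≤ (2 : ℚ) ^ (emin + (p : ℤ) - 1) then
        ((transformK fl p emin xs R).1 :: List.replicate K 0, (transformK fl p emin xs R).2)
      else
        ((transformK fl p emin xs R).1 ::
            (accSumKAux fl p emin K (transformK fl p emin xs R).2.2 (transformK fl p emin xs R).2.1).1,
          (accSumKAux fl p emin K (transformK fl p emin xs R).2.2 (transformK fl p emin xs R).2.1).2)

/-- **ALGORITHM 6.4 (`AccSumK`): accurate summation computing a K-fold faithful rounding.**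
`Res = AccSumK(p, K)`: `p⁽⁰⁾ = p`, `R₀ = 0`; `for k = 1 : K`: `[Res_k, R_k, p⁽ᵏ⁾] = TransformK(p⁽ᵏ⁻¹⁾, R_{k−1})`;
"if `Res_k ∈ U`, `Res_{k+1..K} = 0`, return; end if". The format parameters `p`, `emin` are arguments as in
`transformK`. [cite: RumpOgitaOishi2009, Algorithm 6.4] -/
def accSumK (fl : ℚ → ℚ) (p : ℕ) (emin : ℤ) (xs : List ℚ) (K : ℕ) : List ℚ :=
  (accSumKAux fl p emin K xs 0).1

/-- Algorithm 6.4, no step left. [cite: RumpOgitaOishi2009, Algorithm 6.4] -/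
theorem accSumKAux_zero (fl : ℚ → ℚ) (p : ℕ) (emin : ℤ) (xs : List ℚ) (R : ℚ) :
    accSumKAux fl p emin 0 xs R = ([], R, xs) := rfl

/-- Algorithm 6.4, a step with "`Res_k ∈ U`": `Res_{k+1..K} = 0`, return.
[cite: RumpOgitaOishi2009, Algorithm 6.4] -/
theorem accSumKAux_succ_of_mem_U {K : ℕ} {xs : List ℚ} {R : ℚ}
    (h : |(transformK fl p emin xs R).1| ≤ (2 : ℚ) ^ (emin + (p : ℤ) - 1)) :
    accSumKAux fl p emin (K + 1) xs R =
      ((transformK fl p emin xs R).1 :: List.replicate K 0, (transformK fl p emin xs R).2) := by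
  rw [accSumKAux, if_pos h]

/-- Algorithm 6.4, a step with `Res_k ∉ U`: continue with `(p⁽ᵏ⁾, R_k)`.
[cite: RumpOgitaOishi2009, Algorithm 6.4] -/
theorem accSumKAux_succ_of_not_mem_U {K : ℕ} {xs : List ℚ} {R : ℚ}
    (h : ¬ |(transformK fl p emin xs R).1| ≤ (2 : ℚ) ^ (emin + (p : ℤ) - 1)) :
    accSumKAux fl p emin (K + 1) xs R =
      ((transformK fl p emin xs R).1 ::
          (accSumKAux fl p emin K (transformK fl p emin xs R).2.2 (transformK fl p emin xs R).2.1).1,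
        (accSumKAux fl p emin K (transformK fl p emin xs R).2.2 (transformK fl p emin xs R).2.1).2) := by
  rw [accSumKAux, if_neg h]

/-- The results of the first `k` steps are the first `k` results: `AccSumK(p, k) = (AccSumK(p, K))_{1..k}` for
`k ≤ K` (after a `return` both are padded with zeros). [cite: RumpOgitaOishi2009, Algorithm 6.4] -/
theorem accSumKAux_fst_eq_take (fl : ℚ → ℚ) (p : ℕ) (emin : ℤ) :
    ∀ (k K : ℕ) (xs : List ℚ) (R : ℚ), k ≤ K →
      (accSumKAux fl p emin k xs R).1 = ((accSumKAux fl p emin K xs R).1).take k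
  | 0, K, xs, R, _ => by simp [accSumKAux]
  | _ + 1, 0, _, _, h => absurd h (by omega)
  | k + 1, K + 1, xs, R, h => by
      by_cases hU : |(transformK fl p emin xs R).1| ≤ (2 : ℚ) ^ (emin + (p : ℤ) - 1)
      · rw [accSumKAux_succ_of_mem_U hU, accSumKAux_succ_of_mem_U hU, List.take_succ_cons,
          List.take_replicate, min_eq_left (by omega)]
      · rw [accSumKAux_succ_of_not_mem_U hU, accSumKAux_succ_of_not_mem_U hU, List.take_succ_cons,
          accSumKAux_fst_eq_take fl p emin k K _ _ (by omega)]

/-- `AccSumK(p, k) = (AccSumK(p, K))_{1..k}` for `k ≤ K`. [cite: RumpOgitaOishi2009, Algorithm 6.4] -/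
theorem accSumK_eq_take (fl : ℚ → ℚ) (p : ℕ) (emin : ℤ) (xs : List ℚ) {k K : ℕ} (hk : k ≤ K) :
    accSumK fl p emin xs k = (accSumK fl p emin xs K).take k :=
  accSumKAux_fst_eq_take fl p emin k K xs 0 hk

/-- A sequence of zeros is a K-fold faithful rounding of `0` (`0 ∈ □(0)`).
[cite: RumpOgitaOishi2009, Definition 5.4 / Algorithm 6.4 (`Res_{k+1..K} = 0`)] -/
theorem isKFoldFaithful_replicate_zero : ∀ n : ℕ, IsKFoldFaithful p emin (List.replicate n (0 : ℚ)) 0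
  | 0 => trivial
  | n + 1 => by
      rw [List.replicate_succ, isKFoldFaithful_cons, sub_zero]
      exact ⟨isFaithfulRounding_self (isFloat_zero p emin), isKFoldFaithful_replicate_zero n⟩

/-- **PROPOSITION 6.5, the loop invariant (proof of Proposition 6.5).** For `p⁽ᵏ⁻¹⁾ ∈ Fⁿ`, `2^(2M)eps ≤ 1`
(`M = ⌈log₂(n + 2)⌉`), and an offset `R_{k−1} ∈ F` with `R_{k−1} ∈ epsσ′ℤ` when `p⁽ᵏ⁻¹⁾ ≠ 0` ("by (6.2) the
assumptions of Lemma 6.3 are satisfied for `k ≥ 1` as well"), the remaining steps of Algorithm 6.4 produce `K′`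
results which are a K′-fold faithful rounding of `s_{k−1} + R_{k−1}` ("`Res_k` is a faithful rounding of
`s − Σ_{ν<k} Res_ν`"; `s_{k−1} := Σ p⁽ᵏ⁻¹⁾ᵢ`), non-overlapping (Lemma 6.1), and (6.6)
`s_{k−1} + R_{k−1} = Σ Res_ν + R + Σ pᵢ` for the final state `(R, p)`. At a `return` (`Res_k ∈ U`) the source
argues "`Res_k ∈ U` implies `R_k` and all `p⁽ᵏ⁾ᵢ` to be zero by Lemma 6.3", which does not hold (see the NOTE in
the module docstring: `p = (257, −224)`, `eps = 2⁻¹⁰`, `eta = 1` gives `Res₁ = 33 ∈ U`, `R₁ = −1`, `p⁽¹⁾ = (1, 0)`);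
instead `Res_k = s_{k−1} + R_{k−1}` exactly (a faithful rounding in `U` of a number in `etaℤ`, (5.3)), so the padded
zeros are faithful roundings of the remainders `0`. [cite: RumpOgitaOishi2009, Proposition 6.5 (proof), eq. (6.6)] -/
theorem accSumKAux_spec (hfl : IsRoundNearest p emin fl) :
    ∀ (K : ℕ) {xs : List ℚ} {R : ℚ}, (∀ x ∈ xs, IsFloat p emin x) → 2 * Nat.clog 2 (xs.length + 2) ≤ p →
      IsFloat p emin R →
      (maxAbs xs ≠ 0 →
        OnGrid (unitRoundoff p * (2 : ℚ) ^ ((Nat.clog 2 (xs.length + 2) : ℤ) + Int.clog 2 (maxAbs xs))) R) →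
      (accSumKAux fl p emin K xs R).1.length = K ∧
        IsKFoldFaithful p emin (accSumKAux fl p emin K xs R).1 (xs.sum + R) ∧
        NonOverlapping p (accSumKAux fl p emin K xs R).1 ∧
        xs.sum + R = (accSumKAux fl p emin K xs R).1.sum + (accSumKAux fl p emin K xs R).2.1 +
          (accSumKAux fl p emin K xs R).2.2.sum
  | 0, xs, R, _, _, _, _ => by simp [accSumKAux, add_comm]
  | K + 1, xs, R, hxs, h2M, hR, hRg => by
      have hp : 1 ≤ p := by
        have : 1 ≤ Nat.clog 2 (xs.length + 2) := Nat.clog_pos (by norm_num) (by omega)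
        omega
      obtain ⟨hfaith, h61, -, hRF, hxs'F, hlen, h62, -, -⟩ := transformK_spec hfl hxs h2M hR hRg
      by_cases hU : |(transformK fl p emin xs R).1| ≤ (2 : ℚ) ^ (emin + (p : ℤ) - 1)
      · -- `Res_k ∈ U`: `Res_k = s_{k−1} + R_{k−1}` exactly, the remaining results are `0 ∈ □(0)`
        rw [accSumKAux_succ_of_mem_U hU]
        have hsg : OnGrid ((2 : ℚ) ^ emin) (xs.sum + R) :=
          (onGrid_list_sum fun x hx => onGrid_eta_of_isFloat (hxs x hx)).add (onGrid_eta_of_isFloat hR)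
        have hex : (transformK fl p emin xs R).1 = xs.sum + R := faithful_eq_of_mem_U_of_onGrid hp hfaith hU hsg
        refine ⟨by simp, ⟨hfaith, ?_⟩, (nonOverlapping_singleton _).append_replicate_zero K, ?_⟩
        · rw [hex, sub_self]; exact isKFoldFaithful_replicate_zero K
        · rw [List.sum_cons, List.sum_replicate, nsmul_zero, add_zero]
          linarith only [h61]
      · -- `Res_k ∉ U`: induction, (6.1), and Lemma 6.1 for the pair `(Res_k, Res_{k+1})`
        rw [accSumKAux_succ_of_not_mem_U hU]
        have h2M' : 2 * Nat.clog 2 ((transformK fl p emin xs R).2.2.length + 2) ≤ p := by rw [hlen]; exact h2M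
        obtain ⟨hlenK, hKF, hNO, h66⟩ := accSumKAux_spec hfl K hxs'F h2M' hRF h62
        have h61' : xs.sum + R - (transformK fl p emin xs R).1 =
            (transformK fl p emin xs R).2.2.sum + (transformK fl p emin xs R).2.1 := by rw [h61]; ring
        refine ⟨by rw [List.length_cons, hlenK], ⟨hfaith, by rw [h61']; exact hKF⟩, ?_, ?_⟩
        · rcases hL : (accSumKAux fl p emin K (transformK fl p emin xs R).2.2
              (transformK fl p emin xs R).2.1).1 with _ | ⟨f, l⟩
          · exact nonOverlapping_singleton _
          · rw [hL] at hKF hNO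
            rw [nonOverlapping_cons_cons]
            refine ⟨?_, hNO⟩
            have hf : IsFaithfulRounding p emin f (xs.sum + R - (transformK fl p emin xs R).1) := by
              rw [h61']; exact hKF.1
            exact nonOverlapStep_accSumOffset hfl hxs h2M hR hRg hf
        · rw [List.sum_cons]; linarith only [h61, h66]

/-- The result vector `Res` of Algorithm 6.4 has length `K`. [cite: RumpOgitaOishi2009, Algorithm 6.4] -/
theorem length_accSumK (hfl : IsRoundNearest p emin fl) {xs : List ℚ} (hxs : ∀ x ∈ xs, IsFloat p emin x)
    (h2M : 2 * Nat.clog 2 (xs.length + 2) ≤ p) (K : ℕ) : (accSumK fl p emin xs K).length = K :=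
  (accSumKAux_spec hfl K hxs h2M (isFloat_zero p emin) (fun _ => onGrid_zero _)).1

/-- **PROPOSITION 6.5 (main statement).** Let `p` be a vector of `n` floating-point numbers, `s := Σ pᵢ`,
`M := ⌈log₂(n + 2)⌉`, `2^(2M)eps ≤ 1`, `K ∈ ℕ`, and let `Res` be the result vector of Algorithm 6.4 (`AccSumK`)
applied to `p` and `K`. "Then `Res₁, …, Res_K` is a strongly faithful rounding of `s`" (Definition 5.4: a K-fold
faithful rounding which is non-overlapping). (`K = 0` gives the empty sequence, trivially.)
[cite: RumpOgitaOishi2009, Proposition 6.5] -/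
theorem isStronglyFaithful_accSumK (hfl : IsRoundNearest p emin fl) {xs : List ℚ}
    (hxs : ∀ x ∈ xs, IsFloat p emin x) (h2M : 2 * Nat.clog 2 (xs.length + 2) ≤ p) (K : ℕ) :
    IsStronglyFaithful p emin (accSumK fl p emin xs K) xs.sum := by
  obtain ⟨-, h1, h2, -⟩ := accSumKAux_spec hfl K hxs h2M (isFloat_zero p emin) (fun _ => onGrid_zero _)
  rw [add_zero] at h1
  exact ⟨h1, h2⟩

/-- **PROPOSITION 6.5, eq. (6.6):** `s = Σ_{ν=1}^{K} Res_ν + R_K + Σᵢ p⁽ᴷ⁾ᵢ` with the state `(R_K, p⁽ᴷ⁾)` after the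
loop (frozen at a `return`); for `1 ≤ k ≤ K` apply it to `AccSumK(p, k) = Res_{1..k}` (`accSumK_eq_take`).
[cite: RumpOgitaOishi2009, Proposition 6.5 eq. (6.6)] -/
theorem accSumK_eq_6_6 (hfl : IsRoundNearest p emin fl) {xs : List ℚ} (hxs : ∀ x ∈ xs, IsFloat p emin x)
    (h2M : 2 * Nat.clog 2 (xs.length + 2) ≤ p) (K : ℕ) :
    xs.sum = (accSumK fl p emin xs K).sum + (accSumKAux fl p emin K xs 0).2.1 +
      (accSumKAux fl p emin K xs 0).2.2.sum := by
  have := (accSumKAux_spec hfl K hxs h2M (isFloat_zero p emin) (fun _ => onGrid_zero _)).2.2.2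
  rw [add_zero] at this
  exact this

/-- Lemma 5.5 for sums: if `f₁, …, f_k` is a faithful rounding of `s ∈ etaℤ` and SOME `fᵢ ∈ U`, then
`s = Σ fν` (the members after `fᵢ` vanish, so `f_k ∈ U`, and Proposition 5.6 (5.13) with `s − Σ fν ∈ etaℤ`).
[cite: RumpOgitaOishi2009, Lemma 5.5 / Proposition 6.5 ("`Res_k ∈ U` for some `k` implies `Res = s`")] -/
theorem IsKFoldFaithful.sum_eq_of_exists_mem_U (hp : 1 ≤ p) {l : List ℚ} {s : ℚ}
    (h : IsKFoldFaithful p emin l s) (hs : OnGrid ((2 : ℚ) ^ emin) s)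
    (hex : ∃ f ∈ l, |f| ≤ (2 : ℚ) ^ (emin + p - 1)) : l.sum = s := by
  obtain ⟨f, hf, hfU⟩ := hex
  have hne : l ≠ [] := List.ne_nil_of_mem hf
  obtain ⟨i, hi, rfl⟩ := List.getElem_of_mem hf
  refine h.sum_eq_of_onGrid hp hs hne ?_
  rw [List.getLast_eq_getElem]
  by_cases hil : i = l.length - 1
  · subst hil; exact hfU
  · rw [h.getElem_eq_zero_of_abs_le_threshold hp hs hi (by omega) (by omega) hfU, abs_zero]
    exact (two_zpow_pos _).le

/-- **PROPOSITION 6.5, exact case:** "`Res_k ∈ U` for some `1 ≤ k ≤ K` implies `Res = s`", `Res := Σ Res_k`.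
[cite: RumpOgitaOishi2009, Proposition 6.5] -/
theorem sum_accSumK_eq_of_mem_U (hfl : IsRoundNearest p emin fl) {xs : List ℚ}
    (hxs : ∀ x ∈ xs, IsFloat p emin x) (h2M : 2 * Nat.clog 2 (xs.length + 2) ≤ p) {K : ℕ}
    (hex : ∃ r ∈ accSumK fl p emin xs K, |r| ≤ (2 : ℚ) ^ (emin + p - 1)) :
    (accSumK fl p emin xs K).sum = xs.sum := by
  have hp : 1 ≤ p := by
    have : 1 ≤ Nat.clog 2 (xs.length + 2) := Nat.clog_pos (by norm_num) (by omega)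
    omega
  exact (isStronglyFaithful_accSumK hfl hxs h2M K).1.sum_eq_of_exists_mem_U hp
    (onGrid_list_sum fun x hx => onGrid_eta_of_isFloat (hxs x hx)) hex

/-- **PROPOSITION 6.5, eqs. (6.7)–(6.8):** if `Res_K ∉ U` (equivalently no `Res_k ∈ U`, as a `return` pads with
zeros), then `|s − Res| < 2eps^K·ufp(s) ≤ 2eps^K|s|` (6.7) and `|s − Res| < 2eps^K·ufp(Res₁) ≤ 2eps^K|Res₁|` (6.8)
(Proposition 5.6). [cite: RumpOgitaOishi2009, Proposition 6.5 eqs. (6.7)–(6.8)] -/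
theorem abs_sub_sum_accSumK_lt (hfl : IsRoundNearest p emin fl) {xs : List ℚ}
    (hxs : ∀ x ∈ xs, IsFloat p emin x) (h2M : 2 * Nat.clog 2 (xs.length + 2) ≤ p) {K : ℕ}
    (hne : accSumK fl p emin xs K ≠ [])
    (hU : (2 : ℚ) ^ (emin + p - 1) < |(accSumK fl p emin xs K).getLast hne|) :
    |xs.sum - (accSumK fl p emin xs K).sum| < 2 * unitRoundoff p ^ K * ufp xs.sum ∧
      |xs.sum - (accSumK fl p emin xs K).sum| < 2 * unitRoundoff p ^ K * |xs.sum| ∧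
      |xs.sum - (accSumK fl p emin xs K).sum| <
        2 * unitRoundoff p ^ K * ufp ((accSumK fl p emin xs K).head hne) ∧
      |xs.sum - (accSumK fl p emin xs K).sum| <
        2 * unitRoundoff p ^ K * |(accSumK fl p emin xs K).head hne| := by
  have hp : 1 ≤ p := by
    have : 1 ≤ Nat.clog 2 (xs.length + 2) := Nat.clog_pos (by norm_num) (by omega)
    omega
  have hSF := (isStronglyFaithful_accSumK hfl hxs h2M K).1
  have h := hSF.abs_sub_sum_lt_of_not_mem_U hp hne hU
  have hrel := hSF.abs_sub_sum_lt_rel hp hne hU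
  rw [length_accSumK hfl hxs h2M K] at h hrel
  have hpow : 0 ≤ 2 * unitRoundoff p ^ K := by have := u_pos (p := p); positivity
  refine ⟨h.1, hrel, h.2, lt_of_lt_of_le h.2 (mul_le_mul_of_nonneg_left (ufp_le_abs _) hpow)⟩

/-! ### Proposition 6.5, the printed proof: at a `return`, `R_k` and `p⁽ᵏ⁾` need not vanish — a worked example
(`eps = 2⁻¹⁰`, `eta = 1`, `p = (257, −224)`, any rounding to nearest) -/

/-- Integers of magnitude `< 2¹⁰ = eps⁻¹` are floating-point numbers of the format `eps = 2⁻¹⁰`, `eta = 1`.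
[cite: RumpOgitaOishi2009, Proposition 6.5 (proof) — worked example, §2 (`F`)] -/
private theorem isFloat_ten_of_int (N : ℤ) (hN : |N| < 1024) : IsFloat 10 0 (N : ℚ) :=
  ⟨N, 0, by norm_num; exact hN, le_rfl, by simp⟩

/-- `fl(N) = N` for `|N| < eps⁻¹`. [cite: RumpOgitaOishi2009, Proposition 6.5 (proof) — worked example, §2 (`F`)] -/
private theorem fl_int_ten (hfl : IsRoundNearest 10 0 fl) (N : ℤ) (hN : |N| < 1024 := by norm_num) :
    fl (N : ℚ) = N :=
  fl_eq_self hfl (isFloat_ten_of_int N hN)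

/-- `fl(2305) = 2304` for `eps = 2⁻¹⁰` and ANY rounding to nearest: the floating-point numbers next to `2305`
are `2304 = 9·2⁸` and `2308` (spacing `2eps·2¹¹ = 4`), and `2304` is strictly nearer.
[cite: RumpOgitaOishi2009, Proposition 6.5 (proof) — worked example, §2 eq. (2.8)] -/
private theorem fl_2305 (hfl : IsRoundNearest 10 0 fl) : fl 2305 = 2304 := by
  have h2304 : IsFloat 10 0 (2304 : ℚ) := ⟨9, 8, by norm_num, by norm_num, by norm_num⟩
  have hF : IsFloat 10 0 (fl 2305) := (hfl 2305).1
  have hmin : |2305 - fl 2305| ≤ |2305 - 2304| := (hfl 2305).2 2304 h2304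
  rw [show (2305 : ℚ) - 2304 = 1 by norm_num, abs_one] at hmin
  have h1 := (abs_le.mp hmin).1
  have h2 := (abs_le.mp hmin).2
  have hE : (2 : ℚ) ^ (11 : ℤ) ≤ |fl 2305| := by
    rw [abs_of_nonneg (by linarith)]; norm_num; linarith
  obtain ⟨z, hz⟩ := onGrid_of_isFloat_of_le_abs hF hE
  rw [show (11 : ℤ) - (10 : ℕ) + 1 = 2 by norm_num] at hz
  norm_num at hz
  rw [hz] at h1 h2
  have hz1 : 4 * z ≤ 2306 := by exact_mod_cast (by linarith : (4 : ℚ) * z ≤ 2306)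
  have hz2 : 2304 ≤ 4 * z := by exact_mod_cast (by linarith : (2304 : ℚ) ≤ 4 * z)
  obtain rfl : z = 576 := by omega
  rw [hz]; norm_num

/-- `M = ⌈log₂(n + 2)⌉ = 2` for `n = 2`. [cite: RumpOgitaOishi2009, Proposition 6.5 (proof) — worked example, Lemma 6.3 (`M`)] -/
private theorem clog_two_four : Nat.clog 2 4 = 2 := by
  rw [show (4 : ℕ) = 2 ^ 2 by norm_num, Nat.clog_pow _ _ one_lt_two]

/-- `⌈log₂ μ⌉ = 9` for `μ = 257`. [cite: RumpOgitaOishi2009, Proposition 6.5 (proof) — worked example, Lemma 6.3 (`σ₀`)] -/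
private theorem clog_two_257 : Int.clog 2 (257 : ℚ) = 9 := by
  have h : Nat.clog 2 257 = 9 :=
    le_antisymm (Nat.clog_le_of_le_pow (by norm_num)) ((Nat.lt_clog_iff_pow_lt one_lt_two).mpr (by norm_num))
  rw [show (257 : ℚ) = ((257 : ℕ) : ℚ) by norm_num, Int.clog_natCast, h]
  rfl

/-- `μ = max(|257|, |−224|) = 257`. [cite: RumpOgitaOishi2009, Proposition 6.5 (proof) — worked example, Algorithm 3.3 (`μ`)] -/
private theorem maxAbs_example : maxAbs [257, -224] = 257 := by
  simp [maxAbs]; norm_num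

/-- The exact operations of the example: `fl(f) = f` for `f ∈ {32, 0, 1, 33, −1} ⊆ F`.
[cite: RumpOgitaOishi2009, Proposition 6.5 (proof) — worked example, §2 (`F`)] -/
private theorem fl_example_values (hfl : IsRoundNearest 10 0 fl) :
    fl 32 = 32 ∧ fl 0 = 0 ∧ fl 1 = 1 ∧ fl 33 = 33 ∧ fl (-1) = -1 :=
  ⟨by exact_mod_cast fl_int_ten hfl 32, by exact_mod_cast fl_int_ten hfl 0, by exact_mod_cast fl_int_ten hfl 1,
    by exact_mod_cast fl_int_ten hfl 33, by exact_mod_cast fl_int_ten hfl (-1)⟩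

/-- The example's extraction: `ExtractVector(σ₀, p) = [τ⁽¹⁾, p⁽¹⁾] = [32, (1, 0)]` for `σ₀ = 2^(M + ⌈log₂ μ⌉) = 2048`,
`p = (257, −224)`, `eps = 2⁻¹⁰` (`q₁ = fl(fl(2048 + 257) − 2048) = 2304 − 2048 = 256`, `p′₁ = 1`; `q₂ = −224`,
`p′₂ = 0`; `τ = fl(256 − 224) = 32`). [cite: RumpOgitaOishi2009, Proposition 6.5 (proof) — worked example, Algorithm 3.3 / Part I Algorithm 3.4] -/
theorem extractVector_example (hfl : IsRoundNearest 10 0 fl) :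
    extractVector fl 2048 [257, -224] = (32, [1, 0]) := by
  have h1 : fl (2048 + 257) = 2304 := by norm_num; exact fl_2305 hfl
  have h2 : fl (2304 - 2048) = 256 := by norm_num; exact_mod_cast fl_int_ten hfl 256
  have h3 : fl (257 - 256) = 1 := by norm_num; exact_mod_cast fl_int_ten hfl 1
  have h4 : fl (2048 + -224) = 1824 := by
    norm_num; exact fl_eq_self hfl ⟨57, 5, by norm_num, by norm_num, by norm_num⟩
  have h5 : fl (1824 - 2048) = -224 := by norm_num; exact_mod_cast fl_int_ten hfl (-224)
  have h6 : fl (-224 - -224) = 0 := by norm_num; exact_mod_cast fl_int_ten hfl 0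
  have h7 : fl (0 + 256) = 256 := by norm_num; exact_mod_cast fl_int_ten hfl 256
  have h8 : fl (256 + -224) = 32 := by norm_num; exact_mod_cast fl_int_ten hfl 32
  simp only [extractVector, extractScalar, List.map, List.foldl, h1, h2, h3, h4, h5, h6, h7, h8]

/-- The example's transformation: `Transform(p, 0)` with `Φ = 2^(2M)eps = 2⁻⁶` stops after ONE pass
(`|t⁽¹⁾| = 32 ≥ fl(Φσ₀) = 32`) with `[τ₁, τ₂, p⁽¹⁾, σ] = [32, 0, (1, 0), 2048]` (`FastTwoSum(0, 32) = [32, 0]`).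
[cite: RumpOgitaOishi2009, Proposition 6.5 (proof) — worked example, Algorithm 3.3] -/
theorem transformPhi_example (hfl : IsRoundNearest 10 0 fl) :
    transformPhi fl 10 0 (2 ^ (2 * Nat.clog 2 ([(257 : ℚ), -224].length + 2)) * unitRoundoff 10)
        [257, -224] 0 = (32, 0, [1, 0], 2048) := by
  obtain ⟨h32, h0, -, -, -⟩ := fl_example_values hfl
  have hM : Nat.clog 2 ([(257 : ℚ), -224].length + 2) = 2 := by simp [clog_two_four]
  have hμ : maxAbs [(257 : ℚ), -224] ≠ 0 := by rw [maxAbs_example]; norm_num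
  have habs : |(32 : ℚ)| = 32 := abs_of_nonneg (by norm_num)
  rw [transformPhi, if_neg hμ, hM, maxAbs_example, clog_two_257, transformPhiAux]
  norm_num [fast2Sum, unitRoundoff, h32, h0, habs, extractVector_example hfl]

/-- The example's faithful result: `res = fl(τ₁ + fl(τ₂ + fl(Σ p⁽¹⁾ᵢ))) = fl(32 + fl(0 + 1)) = 33` — and
`res ∈ U`, since `½eps⁻¹eta = 512`. [cite: RumpOgitaOishi2009, Proposition 6.5 (proof) — worked example, Algorithm 6.2 (`res`)] -/
theorem accSumOffset_example (hfl : IsRoundNearest 10 0 fl) : accSumOffset fl 10 0 [257, -224] 0 = 33 := by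
  obtain ⟨-, -, h1, h33, -⟩ := fl_example_values hfl
  rw [accSumOffset, transformPhi_example hfl]
  norm_num [flSum, h1, h33]

/-- The example run of `TransformK`: `[res, R, p′] = TransformK((257, −224), 0) = [33, −1, (1, 0)]`
(`R = fl(τ₂ − fl(res − τ₁)) = fl(0 − 1) = −1`; (6.1) reads `33 − 33 = −1 + 1`).
[cite: RumpOgitaOishi2009, Proposition 6.5 (proof) — worked example, Algorithm 6.2] -/
theorem transformK_example (hfl : IsRoundNearest 10 0 fl) :
    transformK fl 10 0 [257, -224] 0 = (33, -1, [1, 0]) := by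
  obtain ⟨-, -, h1, -, hm1⟩ := fl_example_values hfl
  rw [transformK, accSumOffset_example hfl, transformPhi_example hfl]
  norm_num [h1, hm1]

/-- The example run of `AccSumK` (`K ≥ 1`): the first step gives `Res₁ = 33 ∈ U` (`|33| ≤ 512 = ½eps⁻¹eta`),
so the algorithm returns `Res = (33, 0, …, 0)` with the state `R₁ = −1`, `p⁽¹⁾ = (1, 0)`.
[cite: RumpOgitaOishi2009, Proposition 6.5 (proof) — worked example, Algorithm 6.4] -/
theorem accSumKAux_example (hfl : IsRoundNearest 10 0 fl) (K : ℕ) :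
    accSumKAux fl 10 0 (K + 1) [257, -224] 0 = (33 :: List.replicate K 0, -1, [1, 0]) := by
  have hU : |(transformK fl 10 0 [257, -224] 0).1| ≤ (2 : ℚ) ^ ((0 : ℤ) + ((10 : ℕ) : ℤ) - 1) := by
    rw [transformK_example hfl]; norm_num
  rw [accSumKAux_succ_of_mem_U hU, transformK_example hfl]

/-- **On the printed proof of PROPOSITION 6.5.** The source derives (6.6) from "`Res_k ∈ U` implies `R_k` and
all `p⁽ᵏ⁾ᵢ` to be zero by Lemma 6.3". Lemma 6.3 gives this for `res = 0` only, and it FAILS in general: for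
`eps = 2⁻¹⁰`, `eta = 1` (so `2^(2M)eps = 2⁻⁶ ≤ 1`), `p = (257, −224)` and any rounding to nearest, the first step
of `AccSumK` returns `Res₁ = 33 ∈ U` with `R₁ = −1 ≠ 0` and `p⁽¹⁾ = (1, 0) ≠ 0`. ((6.6) itself holds —
`s = 33 = 33 + (−1) + 1` — and is proved in `accSumKAux_spec` from `Res_k = s_{k−1} + R_{k−1}` at a `return`.)
[cite: RumpOgitaOishi2009, Proposition 6.5 (proof, "`Res_k ∈ U` implies `R_k` and all `p⁽ᵏ⁾ᵢ` to be zero")] -/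
theorem prop_6_5_proof_clause_fails (hfl : IsRoundNearest 10 0 fl) (K : ℕ) :
    (2 : ℚ) ^ (2 * Nat.clog 2 ([(257 : ℚ), -224].length + 2)) * unitRoundoff 10 ≤ 1 ∧
      (∀ x ∈ [(257 : ℚ), -224], IsFloat 10 0 x) ∧
      |((accSumKAux fl 10 0 (K + 1) [257, -224] 0).1.head?.getD 0)| ≤ (2 : ℚ) ^ ((0 : ℤ) + ((10 : ℕ) : ℤ) - 1) ∧
      (accSumKAux fl 10 0 (K + 1) [257, -224] 0).2.1 ≠ 0 ∧
      (accSumKAux fl 10 0 (K + 1) [257, -224] 0).2.2 ≠ [0, 0] := by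
  have hM : Nat.clog 2 ([(257 : ℚ), -224].length + 2) = 2 := by simp [clog_two_four]
  refine ⟨by rw [hM, unitRoundoff]; norm_num, ?_, ?_, ?_, ?_⟩
  · intro x hx
    simp only [List.mem_cons, List.mem_nil_iff, or_false] at hx
    rcases hx with rfl | rfl
    · exact_mod_cast isFloat_ten_of_int 257 (by norm_num)
    · exact_mod_cast isFloat_ten_of_int (-224) (by norm_num)
  all_goals rw [accSumKAux_example hfl K]; norm_num

end Literature.ComputerArithmetic.RumpOgitaOishi2009
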